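import Literature.Barriers.CriticalPhenomena.IsingTrivialityFromDimensionFourProofs
import Literature.Probability.LatticeModels.HighDimTrivialityTreeBound
import HarnessLib

/-!
# Barrier `IsingTrivialityFromDimensionFour`: the `d > 4` estimate from the tree diagram bound

Sibling proof file of `Literature.Barriers.CriticalPhenomena.IsingTrivialityFromDimensionFour`
(theorems only; no statement of that file is changed, no definition, no named fact). It proves
the analytic half of the Aizenman–Fröhlich `d > 4` triviality theorem at `β = β_c` — the bound

  `S(μ; L, r) = Σ_L⁻² ∑_{x ∈ Λ_{rL}⁴} |U₄^μ(x)| ≤ C_d r^{4d} / L^{d-4}`  (`d ≥ 5`, `L, r ≥ 1`)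

for the critical state `μ` (`ursellFourSum_criticalBeta_le_of_treeDiagramBound`; Aizenman, CDM
2020, §8.1 eq. (8.5): "the combination of the two bounds [tree diagram bound (8.2), infrared
bound (8.4)] yields … `R_L(β) ≤ C L^d (χ_L)⁴/(Σ_L)² ≤ C/L^{d-4}`", "omitting some details";
Panis 2023, proof of Thm 5.5; Aizenman–Duminil-Copin 2021, §1.3 "dimension counting" and §6.3,
bounds on (1)–(4) without the `d = 4` improvement factor) — from the tree's finite-graph named
fact `treeDiagramBound` (Aizenman 1982; CDM 2020 Lemma 8.1/(8.2)) and THEOREMS of the tree: the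
infrared bound at `β_c` in `x`-space (`twoPointFree_criticalBeta_upper_holds`: reflection
positivity and Gaussian domination), the Messager–Miracle-Solé comparison
(`twoPointFree_le_of_mul_supNorm_le`), Griffiths' first inequality and the box limits of the
free state, `Σ_L ≥ |Λ_m| χ_m` (`card_mul_sum_box_le_blockSpinVariance`).

Consequently the statement file's corrected `d > 4` displays
`criticalSmearedMGF_bound_highDim_nonneg` (`f ≥ 0`) and `criticalSmearedMGF_bound_highDim_abs`
(signed `f`, printed `|f|`-prefactor) follow from exactly TWO named facts, both finite-graph
random-current statements of Aizenman 1982: `treeDiagramBound` and the upper half of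
Aizenman's inequality `aizenman_pairingSum_sub_nPoint_le_finite`
(`criticalSmearedMGF_bound_highDim_nonneg.of_treeDiagramBound`,
`criticalSmearedMGF_bound_highDim_abs.of_treeDiagramBound`), in place of the DLR-state fact
`Literature.Probability.LatticeModels.panis_mgf_normalizedField_bound` (Panis Thm 5.5 as a whole)
used by `….of_facts` in `IsingTrivialityFromDimensionFourProofs`; and the barrier itself follows
from these two facts and the `d = 4` bound `aizenmanDuminilCopin_ursellFourSum_le`
(`IsingTrivialityFromDimensionFour.of_treeDiagramBound`).

## The estimate (Part A is model-free: a function `S ≥ 0` on `ℤ^d` with the MMS comparison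
`S(z) ≤ S(w)` for `d‖w‖_∞ ≤ ‖z‖_∞` and the decay `S(v) ≤ C₀ ‖v‖_∞^{2-d}`)

Write `χ_m = ∑_{Λ_m} S`, `T(u) = ∑_{a ∈ Λ_R} S(a - u)`, `R = ⌊rL⌋`, `n = ⌊L⌋`, `m₀ = ⌊n/2d⌋`.
* near sites `‖u‖_∞ ≤ 2R`: `T(u) ≤ χ_{3R}`, and `χ_{3R} ≤ χ_{m₀} (1 + |Λ_{3R}|/|Λ_{⌊(m₀+1)/d⌋}|)`
  (one MMS step: a site of `Λ_{3R} ∖ Λ_{m₀}` is below the average of `S` over `Λ_{⌊(m₀+1)/d⌋}`)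
  and `χ_{3R} ≤ C₁ (3R+1)²` (infrared bound summed over shells);
* far sites `‖u‖_∞ = k > 2R`: `T(u) ≤ |Λ_R| χ_{m₀}/|Λ_{m₀}|` (MMS) and
  `T(u) ≤ |Λ_R| C₀ 2^{d-2}/(k+1)^{d-2}` (infrared bound), two factors each, and
  `∑_{k > 2R} |∂Λ_k| (k+1)^{-(2d-4)} ≤ 2d 3^{d-1}/(2R+1)^{d-4}` — the only place where `d > 4` enters;
* `∑_{u ∈ Λ_M} T(u)⁴` is thus bounded uniformly in the volume `Λ_M`
  (`sum_box_shiftSum_pow_four_le`); the tree diagram bound smeared over `Λ_R⁴` in the free box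
  `Λ_M` (`sum_abs_connectedFour_box_le_of_treeDiagramBound`) passes to the state `μ`
  (`sum_abs_connectedFour_le_of_forall_box`), and `Σ_L ≥ |Λ_{m₀}| χ_{m₀}` with
  `|Λ_{m₀}| ≥ (L/4d)^d` gives `S(μ; L, r) ≤ (K_near r^{3d+4} + K_far r^{4d})/L^{d-4}`.
No sliding-scale infrared bound (ADC Thm 5.6) and no lower bound on the two-point function is
needed for `d > 4`.

## References

* M. Aizenman, *Geometric analysis of `φ⁴` fields and Ising models*, Comm. Math. Phys. 86 (1982)
  [AizenmanCMP1982]; J. Fröhlich, Nucl. Phys. B 200 (1982) [FrohlichTrivialityNPB1982].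
* M. Aizenman, CDM 2020 (arXiv:2112.04248), §7 (7.9)–(7.11), Lemma 8.1, (8.2)–(8.5) [AizenmanCDM2020].
* M. Aizenman, H. Duminil-Copin, Ann. of Math. 194 (2021) (arXiv:1912.07973), §1.3, §5.1
  (5.3), §5.3, §6.3 [AizenmanDuminilCopinAnnals2021].
* R. Panis, arXiv:2309.05797, Thm 5.5 and its proof [Panis2023Triviality].
* H. Duminil-Copin, Proc. ICM 2022, §6.4 [DuminilCopinICM2022].
-/

noncomputable section

open MeasureTheory Filter Topology Finset
open Literature.Probability.LatticeModels Literature.Probability.Percolation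

namespace Literature.Barriers.CriticalPhenomena

variable {d : ℕ}

/-! ### A. Lattice sums of a two-point function with the MMS comparison and the infrared bound -/

section LatticeSums

variable {S : Site d → ℝ}

/-- Box sums of a non-negative function increase with the box. [folklore] -/
theorem sum_box_mono (hS0 : ∀ v, 0 ≤ S v) {m m' : ℕ} (h : m ≤ m') :
    ∑ v ∈ box d m, S v ≤ ∑ v ∈ box d m', S v :=
  Finset.sum_le_sum_of_subset_of_nonneg (box_mono d h) fun v _ _ => hS0 v

/-- `1 ≤ ∑_{v ∈ Λ_m} S(v)` when `S ≥ 0` and `S(0) = 1`. [folklore] -/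
theorem one_le_sum_box (hS0 : ∀ v, 0 ≤ S v) (hS00 : S 0 = 1) (m : ℕ) :
    (1 : ℝ) ≤ ∑ v ∈ box d m, S v := by
  calc (1 : ℝ) = S 0 := hS00.symm
    _ ≤ ∑ v ∈ box d m, S v := Finset.single_le_sum (fun v _ => hS0 v) (zero_mem_box d m)

/-- **MMS comparison, averaged over a box** (Aizenman–Duminil-Copin 2021, §5.1 eq. (5.3) and
§6.3, bound on (2): `S(v) ≤ S(y)` for all `y ∈ Λ_m` once `d m ≤ ‖v‖_∞`, hence
`|Λ_m| S(v) ≤ ∑_{y ∈ Λ_m} S(y)`). [cite: AizenmanDuminilCopinAnnals2021, arXiv:1912.07973 §5.1 eq. (5.3) and §6.3 (bound on (2), p. 26)] -/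
theorem card_box_mul_le_sum_box_of_mms
    (hMMS : ∀ z w : Site d, d * Site.supNorm w ≤ Site.supNorm z → S z ≤ S w)
    {v : Site d} {m : ℕ} (h : d * m ≤ Site.supNorm v) :
    (#(box d m) : ℝ) * S v ≤ ∑ y ∈ box d m, S y := by
  calc (#(box d m) : ℝ) * S v = ∑ _y ∈ box d m, S v := by rw [Finset.sum_const, nsmul_eq_mul]
    _ ≤ ∑ y ∈ box d m, S y := Finset.sum_le_sum fun y hy => by
        refine hMMS v y ((Nat.mul_le_mul_left d ?_).trans h)
        exact mem_box_iff_supNorm_le.1 hy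

/-- **One-step MMS comparison of box sums across scales**: for `2 ≤ d` and `ℓ ≤ M`,
`∑_{Λ_M} S ≤ (∑_{Λ_ℓ} S) · (1 + |Λ_M| / |Λ_{⌊(ℓ+1)/d⌋}|)`: the points of `Λ_M ∖ Λ_ℓ` have
`‖v‖_∞ ≥ ℓ + 1 ≥ d ⌊(ℓ+1)/d⌋`, so each is bounded by the average of `S` over `Λ_{⌊(ℓ+1)/d⌋}`,
itself at most `(∑_{Λ_ℓ} S)/|Λ_{⌊(ℓ+1)/d⌋}|` (the "more naive application of the
Messager–Miracle-Solé inequality" of Aizenman–Duminil-Copin 2021, §5.3, remark after Thm 5.6).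
[cite: AizenmanDuminilCopinAnnals2021, arXiv:1912.07973 §5.3 (display after Thm 5.6, p. 18)] -/
theorem sum_box_le_sum_box_mul (hS0 : ∀ v, 0 ≤ S v)
    (hMMS : ∀ z w : Site d, d * Site.supNorm w ≤ Site.supNorm z → S z ≤ S w)
    (hd : 2 ≤ d) {ℓ M : ℕ} (hℓM : ℓ ≤ M) :
    ∑ v ∈ box d M, S v ≤
      (∑ v ∈ box d ℓ, S v) * (1 + (#(box d M) : ℝ) / #(box d ((ℓ + 1) / d))) := by
  set m : ℕ := (ℓ + 1) / d with hm
  have hmℓ : m ≤ ℓ := by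
    rw [hm]
    rcases Nat.eq_zero_or_pos ℓ with h0 | hpos
    · subst h0
      simp only [zero_add]
      exact (Nat.div_eq_of_lt (by omega)).le
    · calc (ℓ + 1) / d ≤ (ℓ + 1) / 2 := Nat.div_le_div_left hd two_pos
        _ ≤ ℓ := by omega
  have hcard : (0 : ℝ) < #(box d m) := by
    rw [card_box]; positivity
  have hχ0 : 0 ≤ ∑ v ∈ box d ℓ, S v := Finset.sum_nonneg fun v _ => hS0 v
  -- points outside `Λ_ℓ` are bounded by the average over `Λ_m`
  have hout : ∀ v ∈ box d M \ box d ℓ, S v ≤ (∑ y ∈ box d ℓ, S y) / #(box d m) := by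
    intro v hv
    rw [Finset.mem_sdiff, mem_box_iff_supNorm_le, mem_box_iff_supNorm_le] at hv
    have hvℓ : ℓ + 1 ≤ Site.supNorm v := by omega
    have hdm : d * m ≤ Site.supNorm v := (Nat.mul_div_le (ℓ + 1) d).trans hvℓ
    rw [le_div_iff₀ hcard, mul_comm]
    exact (card_box_mul_le_sum_box_of_mms hMMS hdm).trans (sum_box_mono hS0 hmℓ)
  have hsplit : ∑ v ∈ box d M, S v =
      ∑ v ∈ box d ℓ, S v + ∑ v ∈ box d M \ box d ℓ, S v := by
    rw [← Finset.sum_sdiff (box_mono d hℓM), add_comm]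
  rw [hsplit, mul_add, mul_one]
  gcongr
  calc ∑ v ∈ box d M \ box d ℓ, S v
      ≤ ∑ _v ∈ box d M \ box d ℓ, (∑ y ∈ box d ℓ, S y) / #(box d m) := Finset.sum_le_sum hout
    _ = (#(box d M \ box d ℓ) : ℝ) * ((∑ y ∈ box d ℓ, S y) / #(box d m)) := by
        rw [Finset.sum_const, nsmul_eq_mul]
    _ ≤ (#(box d M) : ℝ) * ((∑ y ∈ box d ℓ, S y) / #(box d m)) := by
        have hnn : 0 ≤ (∑ y ∈ box d ℓ, S y) / #(box d m) := div_nonneg hχ0 hcard.le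
        have hc : (#(box d M \ box d ℓ) : ℝ) ≤ #(box d M) := by
          exact_mod_cast Finset.card_le_card Finset.sdiff_subset
        exact mul_le_mul_of_nonneg_right hc hnn
    _ = (∑ v ∈ box d ℓ, S v) * ((#(box d M) : ℝ) / #(box d m)) := by ring

/-- **A shell of the infrared bound**: if `S(v) ≤ C₀ ‖v‖_∞^{2-d}` off the origin (`d ≥ 2`,
`C₀ ≥ 0`), then `∑_{‖v‖_∞ = k+1} S(v) ≤ 2d·3^{d-1}·C₀·(k+1)`, using
`|∂Λ_{k+1}| ≤ 2d (2k+3)^{d-1} ≤ 2d (3(k+1))^{d-1}` (Aizenman–Duminil-Copin 2021, §6.3: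
"the Infrared Bound (eq:IB) to write `χ_L(β) ≤ C₆ L²`"). [cite: AizenmanDuminilCopinAnnals2021, arXiv:1912.07973 §6.3 (χ_L ≤ C₆L², p. 26)] -/
theorem sum_sphere_succ_le_of_decay (hd : 2 ≤ d) {C₀ : ℝ} (hC₀ : 0 ≤ C₀)
    (hIR : ∀ v : Site d, v ≠ 0 → S v ≤ C₀ / (Site.supNorm v : ℝ) ^ (d - 2)) (k : ℕ) :
    ∑ v ∈ sphere d (k + 1), S v ≤ 2 * d * 3 ^ (d - 1) * C₀ * (k + 1) := by
  have hpt : ∀ v ∈ sphere d (k + 1), S v ≤ C₀ / ((k : ℝ) + 1) ^ (d - 2) := by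
    intro v hv
    have hvn : Site.supNorm v = k + 1 := mem_sphere.1 hv
    have hv0 : v ≠ 0 := fun h => by rw [h, Site.supNorm_eq_zero_iff.2 rfl] at hvn; omega
    have h := hIR v hv0
    rw [hvn] at h
    exact_mod_cast h
  have hk1 : (0 : ℝ) < (k : ℝ) + 1 := by positivity
  calc ∑ v ∈ sphere d (k + 1), S v
      ≤ ∑ _v ∈ sphere d (k + 1), C₀ / ((k : ℝ) + 1) ^ (d - 2) := Finset.sum_le_sum hpt
    _ = (#(sphere d (k + 1)) : ℝ) * (C₀ / ((k : ℝ) + 1) ^ (d - 2)) := by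
        rw [Finset.sum_const, nsmul_eq_mul]
    _ ≤ (2 * d * (2 * k + 3 : ℝ) ^ (d - 1)) * (C₀ / ((k : ℝ) + 1) ^ (d - 2)) := by
        gcongr
        exact card_sphere_succ_le k
    _ ≤ (2 * d * (3 * ((k : ℝ) + 1)) ^ (d - 1)) * (C₀ / ((k : ℝ) + 1) ^ (d - 2)) := by
        gcongr
        linarith
    _ = 2 * d * 3 ^ (d - 1) * C₀ * (((k : ℝ) + 1) ^ (d - 1) / ((k : ℝ) + 1) ^ (d - 2)) := by
        rw [mul_pow]; ring
    _ = 2 * d * 3 ^ (d - 1) * C₀ * (k + 1) := by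
        congr 1
        rw [div_eq_iff (pow_ne_zero _ hk1.ne'), ← pow_succ']
        congr 1
        omega

/-- **The truncated susceptibility grows at most quadratically under the infrared bound**:
`∑_{v ∈ Λ_n} S(v) ≤ (S(0) + 2d·3^{d-1}·C₀) (n+1)²` (Aizenman–Duminil-Copin 2021, §6.3,
`χ_L(β) ≤ C₆ L²`; Aizenman CDM 2020, §8.1, the infrared bound (8.4) in (8.5)). [cite: AizenmanDuminilCopinAnnals2021, arXiv:1912.07973 §6.3 (χ_L ≤ C₆L², p. 26)] [cite: AizenmanCDM2020, §8.1 eqs. (8.4)–(8.5)] -/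
theorem sum_box_le_sq_of_decay (hd : 2 ≤ d) (hS00 : 0 ≤ S 0) {C₀ : ℝ} (hC₀ : 0 ≤ C₀)
    (hIR : ∀ v : Site d, v ≠ 0 → S v ≤ C₀ / (Site.supNorm v : ℝ) ^ (d - 2)) (n : ℕ) :
    ∑ v ∈ box d n, S v ≤ (S 0 + 2 * d * 3 ^ (d - 1) * C₀) * ((n : ℝ) + 1) ^ 2 := by
  set K : ℝ := 2 * d * 3 ^ (d - 1) * C₀ with hK
  have hK0 : 0 ≤ K := by positivity
  rw [sum_box_eq_sum_sphere, Finset.sum_range_succ', sphere_zero, Finset.sum_singleton]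
  calc ∑ k ∈ Finset.range n, ∑ v ∈ sphere d (k + 1), S v + S 0
      ≤ ∑ k ∈ Finset.range n, K * ((n : ℝ) + 1) + S 0 := by
        gcongr with k hk
        refine (sum_sphere_succ_le_of_decay hd hC₀ hIR k).trans ?_
        rw [← hK]
        gcongr
        exact_mod_cast (Finset.mem_range.1 hk).le
    _ = n * (K * ((n : ℝ) + 1)) + S 0 := by
        rw [Finset.sum_const, Finset.card_range, nsmul_eq_mul]
    _ ≤ (S 0 + K) * ((n : ℝ) + 1) ^ 2 := by
        have hn : (0 : ℝ) ≤ n := Nat.cast_nonneg n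
        have h1 : (n : ℝ) * (K * ((n : ℝ) + 1)) ≤ ((n : ℝ) + 1) * (K * ((n : ℝ) + 1)) :=
          mul_le_mul_of_nonneg_right (by linarith) (by positivity)
        have h2 : S 0 ≤ S 0 * ((n : ℝ) + 1) ^ 2 :=
          le_mul_of_one_le_right hS00 (by nlinarith)
        nlinarith


/-- Telescoping: `∑_{i<N} 1/((a+i)(a+i+1)) ≤ 1/a` for `a > 0`. [folklore] -/
theorem sum_range_inv_mul_succ_le {a : ℝ} (ha : 0 < a) (N : ℕ) :
    ∑ i ∈ Finset.range N, 1 / ((a + i) * (a + i + 1)) ≤ 1 / a := by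
  have htel := Finset.sum_range_sub' (fun i : ℕ => 1 / (a + i)) N
  simp only [Nat.cast_zero, add_zero] at htel
  have hterm : ∀ i ∈ Finset.range N,
      1 / ((a + i) * (a + i + 1)) = 1 / (a + i) - 1 / (a + (i + 1 : ℕ)) := by
    intro i _
    have h1 : (0 : ℝ) < a + i := by positivity
    have h2 : (0 : ℝ) < a + i + 1 := by positivity
    push_cast
    field_simp
    ring
  rw [Finset.sum_congr rfl hterm, htel]
  have : 0 ≤ 1 / (a + N) := by positivity
  linarith

/-- `|∂Λ_k| ≤ 2d (3k)^{d-1}` for `k ≥ 1`. [folklore] -/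
theorem card_sphere_le_of_pos {k : ℕ} (hk : 1 ≤ k) :
    (#(sphere d k) : ℝ) ≤ 2 * d * (3 * (k : ℝ)) ^ (d - 1) := by
  obtain ⟨j, rfl⟩ : ∃ j, k = j + 1 := ⟨k - 1, by omega⟩
  refine (card_sphere_succ_le j).trans ?_
  push_cast
  gcongr
  linarith

/-- **The far shells are summable in `d > 4`**: for `a ≥ 1`,
`∑_{a ≤ k < b} |∂Λ_k| / (k+1)^{2d-4} ≤ 2d·3^{d-1} / a^{d-4}` (`|∂Λ_k| ≤ 2d(3k)^{d-1}` and
`∑_{k ≥ a} k^{-(d-3)} ≤ a^{-(d-5)} ∑_{k ≥ a} 1/(k(k+1)) ≤ a^{4-d}`; this is the dimension count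
"the sum in the tree diagram bound contributes a factor `L^d` while the summand has two extra
correlation function factors … each dominated by `1/L^{d-2}`" of Aizenman–Duminil-Copin 2021,
§1.3, in the form needed for sites far from the box). [cite: AizenmanDuminilCopinAnnals2021, arXiv:1912.07973 §1.3 (dimension counting, p. 6)] -/
theorem sum_Ico_card_sphere_div_pow_le (hd : 5 ≤ d) {a : ℕ} (ha : 1 ≤ a) (b : ℕ) :
    ∑ k ∈ Finset.Ico a b, (#(sphere d k) : ℝ) / ((k : ℝ) + 1) ^ (2 * d - 4) ≤
      2 * d * 3 ^ (d - 1) / (a : ℝ) ^ (d - 4) := by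
  have ha0 : (0 : ℝ) < a := by exact_mod_cast ha
  -- termwise bound by a telescoping sequence
  have hterm : ∀ k ∈ Finset.Ico a b, (#(sphere d k) : ℝ) / ((k : ℝ) + 1) ^ (2 * d - 4) ≤
      2 * d * 3 ^ (d - 1) / (a : ℝ) ^ (d - 5) * (1 / ((k : ℝ) * ((k : ℝ) + 1))) := by
    intro k hk
    have hak : a ≤ k := (Finset.mem_Ico.1 hk).1
    have hk1 : 1 ≤ k := ha.trans hak
    have hk0 : (0 : ℝ) < k := by exact_mod_cast hk1
    have hak' : (a : ℝ) ≤ k := by exact_mod_cast hak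
    have hcard := card_sphere_le_of_pos (d := d) hk1
    -- `(k+1)^{2d-4} ≥ k^{d-1} · a^{d-5} · k · (k+1)` up to the factor `3^{d-1}` bookkeeping
    have hsplit : ((k : ℝ) + 1) ^ (2 * d - 4) =
        ((k : ℝ) + 1) ^ (d - 1) * (((k : ℝ) + 1) ^ (d - 5) * ((k : ℝ) + 1) ^ 2) := by
      rw [← pow_add, ← pow_add]; congr 1; omega
    rw [div_le_iff₀ (by positivity), hsplit]
    have h1 : (3 * (k : ℝ)) ^ (d - 1) ≤ (3 * ((k : ℝ) + 1)) ^ (d - 1) := by gcongr; linarith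
    have h2 : (a : ℝ) ^ (d - 5) ≤ ((k : ℝ) + 1) ^ (d - 5) := pow_le_pow_left₀ ha0.le (by linarith) _
    have h3 : (k : ℝ) * ((k : ℝ) + 1) ≤ ((k : ℝ) + 1) ^ 2 := by nlinarith
    calc (#(sphere d k) : ℝ) ≤ 2 * d * (3 * (k : ℝ)) ^ (d - 1) := hcard
      _ ≤ 2 * d * (3 * ((k : ℝ) + 1)) ^ (d - 1) := by gcongr
      _ = 2 * d * 3 ^ (d - 1) / (a : ℝ) ^ (d - 5) * (1 / ((k : ℝ) * ((k : ℝ) + 1))) *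
            (((k : ℝ) + 1) ^ (d - 1) * ((a : ℝ) ^ (d - 5) * ((k : ℝ) * ((k : ℝ) + 1)))) := by
          rw [mul_pow]; field_simp
      _ ≤ 2 * d * 3 ^ (d - 1) / (a : ℝ) ^ (d - 5) * (1 / ((k : ℝ) * ((k : ℝ) + 1))) *
            (((k : ℝ) + 1) ^ (d - 1) * (((k : ℝ) + 1) ^ (d - 5) * ((k : ℝ) + 1) ^ 2)) := by
          gcongr
  refine (Finset.sum_le_sum hterm).trans ?_
  rw [← Finset.mul_sum, Finset.sum_Ico_eq_sum_range]
  have htel : ∑ i ∈ Finset.range (b - a), 1 / (((a + i : ℕ) : ℝ) * (((a + i : ℕ) : ℝ) + 1)) ≤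
      1 / (a : ℝ) := by
    have h := sum_range_inv_mul_succ_le ha0 (b - a)
    refine le_of_eq_of_le (Finset.sum_congr rfl fun i _ => ?_) h
    push_cast; ring
  calc 2 * d * 3 ^ (d - 1) / (a : ℝ) ^ (d - 5) *
        ∑ i ∈ Finset.range (b - a), 1 / (((a + i : ℕ) : ℝ) * (((a + i : ℕ) : ℝ) + 1))
      ≤ 2 * d * 3 ^ (d - 1) / (a : ℝ) ^ (d - 5) * (1 / (a : ℝ)) := by gcongr
    _ = 2 * d * 3 ^ (d - 1) / (a : ℝ) ^ (d - 4) := by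
        rw [div_mul_div_comm, mul_one, ← pow_succ]
        congr 2; omega

/-- Sup-norm geometry of a far site: if `‖u‖_∞ = k` and `a ∈ Λ_R` then `k ≤ ‖a - u‖_∞ + R`.
[folklore] -/
theorem supNorm_le_supNorm_sub_add_of_mem_box {u a : Site d} {k R : ℕ}
    (hu : Site.supNorm u = k) (ha : a ∈ box d R) : k ≤ Site.supNorm (a - u) + R := by
  have h1 := Site.supNorm_le_supNorm_sub_add u a
  have h2 : Site.supNorm (u - a) = Site.supNorm (a - u) := by
    rw [← Site.supNorm_neg, neg_sub]
  have h3 : Site.supNorm a ≤ R := mem_box_iff_supNorm_le.1 ha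
  omega

/-- **Near sites**: for `‖u‖_∞ ≤ 2R`, `∑_{a ∈ Λ_R} S(a - u) ≤ ∑_{v ∈ Λ_{3R}} S(v)`
(`a - u ∈ Λ_{3R}`, `a ↦ a - u` injective; `χ_{2drL}`-type bound of Aizenman–Duminil-Copin
2021, §6.3, bound on (1)). [cite: AizenmanDuminilCopinAnnals2021, arXiv:1912.07973 §6.3 (bound on (1), p. 26)] -/
theorem sum_shift_le_sum_box_of_near (hS0 : ∀ v, 0 ≤ S v) {R : ℕ} {u : Site d}
    (hu : Site.supNorm u ≤ 2 * R) :
    ∑ a ∈ box d R, S (a - u) ≤ ∑ v ∈ box d (3 * R), S v := by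
  rw [← Finset.sum_image (f := S) (s := box d R) (g := fun a => a - u)
    (fun a _ b _ h => sub_left_injective h)]
  refine Finset.sum_le_sum_of_subset_of_nonneg (fun v hv => ?_) fun v _ _ => hS0 v
  obtain ⟨a, ha, rfl⟩ := Finset.mem_image.1 hv
  rw [mem_box_iff_supNorm_le] at ha ⊢
  have h := Site.supNorm_add_le a (-u)
  rw [← sub_eq_add_neg, Site.supNorm_neg] at h
  omega

/-- **Far sites, Messager–Miracle-Solé**: for `‖u‖_∞ = k ≥ 2R + 1` and `d m₀ ≤ R + 1`, every
`a ∈ Λ_R` has `‖a - u‖_∞ ≥ R + 1 ≥ d m₀`, so `S(a - u) ≤ (∑_{Λ_{m₀}} S)/|Λ_{m₀}|` and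
`∑_{a ∈ Λ_R} S(a - u) ≤ |Λ_R| (∑_{Λ_{m₀}} S)/|Λ_{m₀}|` (Aizenman–Duminil-Copin 2021, §6.3,
bound on (2): "(eq:MMS3) … `⟨σ_xσ_{x_i}⟩_β ≤ C₁₀ |x|^{-4} χ_{|x|/d}(β)`"). [cite: AizenmanDuminilCopinAnnals2021, arXiv:1912.07973 §6.3 (bound on (2), p. 26)] -/
theorem sum_shift_le_of_far_mms
    (hMMS : ∀ z w : Site d, d * Site.supNorm w ≤ Site.supNorm z → S z ≤ S w)
    {R m₀ k : ℕ} (hm₀ : d * m₀ ≤ R + 1) (hk : 2 * R + 1 ≤ k) {u : Site d}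
    (hu : Site.supNorm u = k) :
    ∑ a ∈ box d R, S (a - u) ≤ #(box d R) * ((∑ v ∈ box d m₀, S v) / #(box d m₀)) := by
  have hcard : (0 : ℝ) < #(box d m₀) := by rw [card_box]; positivity
  calc ∑ a ∈ box d R, S (a - u) ≤ ∑ _a ∈ box d R, (∑ v ∈ box d m₀, S v) / #(box d m₀) := by
        refine Finset.sum_le_sum fun a ha => ?_
        have hfar := supNorm_le_supNorm_sub_add_of_mem_box hu ha
        rw [le_div_iff₀ hcard, mul_comm]
        exact card_box_mul_le_sum_box_of_mms hMMS (by omega)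
    _ = #(box d R) * ((∑ v ∈ box d m₀, S v) / #(box d m₀)) := by
        rw [Finset.sum_const, nsmul_eq_mul]

/-- **Far sites, infrared bound**: for `‖u‖_∞ = k ≥ 2R + 1`, every `a ∈ Λ_R` has
`‖a - u‖_∞ ≥ k - R ≥ (k+1)/2`, so `S(a - u) ≤ C₀ 2^{d-2}/(k+1)^{d-2}` and
`∑_{a ∈ Λ_R} S(a - u) ≤ |Λ_R| C₀ 2^{d-2} / (k+1)^{d-2}` (Aizenman–Duminil-Copin 2021, §6.3,
bound on (2)–(4): "the other two using the Infrared Bound (eq:IB)"). [cite: AizenmanDuminilCopinAnnals2021, arXiv:1912.07973 §6.3 (bounds on (2)–(4), p. 26)] -/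
theorem sum_shift_le_of_far_decay {C₀ : ℝ} (hC₀ : 0 ≤ C₀)
    (hIR : ∀ v : Site d, v ≠ 0 → S v ≤ C₀ / (Site.supNorm v : ℝ) ^ (d - 2))
    {R k : ℕ} (hk : 2 * R + 1 ≤ k) {u : Site d} (hu : Site.supNorm u = k) :
    ∑ a ∈ box d R, S (a - u) ≤ #(box d R) * (C₀ * 2 ^ (d - 2) / ((k : ℝ) + 1) ^ (d - 2)) := by
  have hk1 : (0 : ℝ) < (k : ℝ) + 1 := by positivity
  calc ∑ a ∈ box d R, S (a - u)
      ≤ ∑ _a ∈ box d R, C₀ * 2 ^ (d - 2) / ((k : ℝ) + 1) ^ (d - 2) := by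
        refine Finset.sum_le_sum fun a ha => ?_
        have hfar := supNorm_le_supNorm_sub_add_of_mem_box hu ha
        set s : ℕ := Site.supNorm (a - u) with hs
        have hs2 : k + 1 ≤ 2 * s := by omega
        have hs0 : 1 ≤ s := by omega
        have hne : a - u ≠ 0 := fun h => by
          rw [h, Site.supNorm_eq_zero_iff.2 rfl] at hs; omega
        have hsR : (k : ℝ) + 1 ≤ 2 * (s : ℝ) := by exact_mod_cast hs2
        have hspos : (0 : ℝ) < s := by exact_mod_cast hs0
        calc S (a - u) ≤ C₀ / (s : ℝ) ^ (d - 2) := hIR _ hne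
          _ ≤ C₀ / (((k : ℝ) + 1) / 2) ^ (d - 2) := by
              refine div_le_div_of_nonneg_left hC₀ (by positivity) ?_
              exact pow_le_pow_left₀ (by positivity) (by linarith) _
          _ = C₀ * 2 ^ (d - 2) / ((k : ℝ) + 1) ^ (d - 2) := by
              rw [div_pow]; field_simp
    _ = #(box d R) * (C₀ * 2 ^ (d - 2) / ((k : ℝ) + 1) ^ (d - 2)) := by
        rw [Finset.sum_const, nsmul_eq_mul]
set_option maxHeartbeats 400000 in -- buildfix (bf3-g26): 160k/180k FAIL, 200k PASS at accept time; line-neutral budget line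
/-- **The sum over all sites of the fourth power of the box-smeared two-point function is
bounded uniformly in the volume, in `d > 4`.** With `T(u) = ∑_{a ∈ Λ_R} S(a - u)`,
`∑_{u ∈ Λ_M} T(u)⁴ ≤ |Λ_{2R}| χ_{3R}⁴ + |Λ_R|⁴ (χ_{m₀}/|Λ_{m₀}|)² (C₀2^{d-2})² · 2d3^{d-1}/(2R+1)^{d-4}`
for every `M`, where `χ_m = ∑_{Λ_m} S` and `d m₀ ≤ R + 1`: near sites (`‖u‖_∞ ≤ 2R`) by
`sum_shift_le_sum_box_of_near`, far sites by two factors of `sum_shift_le_of_far_mms` and two of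
`sum_shift_le_of_far_decay`, summed shell by shell (`sum_Ico_card_sphere_div_pow_le`). This is
the numerator of Aizenman's bound `R_L(β) ≤ C L^d χ⁴/Σ_L² ≤ C/L^{d-4}` (Aizenman, CDM 2020,
§8.1 eq. (8.5), "omitting some details"; Aizenman–Duminil-Copin 2021, §6.3, bounds on (1)–(4)
without the improvement factor `B_L^{-c}`). [cite: AizenmanCDM2020, §8.1 eq. (8.5)] [cite: AizenmanDuminilCopinAnnals2021, arXiv:1912.07973 §6.3 (bounds on (1)–(4), p. 26)] -/
theorem sum_box_shiftSum_pow_four_le (hd : 5 ≤ d) (hS0 : ∀ v, 0 ≤ S v)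
    (hMMS : ∀ z w : Site d, d * Site.supNorm w ≤ Site.supNorm z → S z ≤ S w)
    {C₀ : ℝ} (hC₀ : 0 ≤ C₀)
    (hIR : ∀ v : Site d, v ≠ 0 → S v ≤ C₀ / (Site.supNorm v : ℝ) ^ (d - 2))
    {R m₀ : ℕ} (hm₀ : d * m₀ ≤ R + 1) (M : ℕ) :
    ∑ u ∈ box d M, (∑ a ∈ box d R, S (a - u)) ^ 4 ≤
      #(box d (2 * R)) * (∑ v ∈ box d (3 * R), S v) ^ 4 +
        (#(box d R) : ℝ) ^ 4 * ((∑ v ∈ box d m₀, S v) / #(box d m₀)) ^ 2 *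
          (C₀ * 2 ^ (d - 2)) ^ 2 * (2 * d * 3 ^ (d - 1) / (2 * (R : ℝ) + 1) ^ (d - 4)) := by
  classical
  set T : Site d → ℝ := fun u => ∑ a ∈ box d R, S (a - u) with hT
  have hT0 : ∀ u, 0 ≤ T u := fun u => Finset.sum_nonneg fun a _ => hS0 _
  set χ₃ : ℝ := ∑ v ∈ box d (3 * R), S v with hχ₃
  set A : ℝ := #(box d R) * ((∑ v ∈ box d m₀, S v) / #(box d m₀)) with hA
  set B : ℝ := #(box d R) * (C₀ * 2 ^ (d - 2)) with hB
  have hA0 : 0 ≤ A := by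
    rw [hA]
    exact mul_nonneg (Nat.cast_nonneg _)
      (div_nonneg (Finset.sum_nonneg fun v _ => hS0 v) (Nat.cast_nonneg _))
  have hB0 : 0 ≤ B := by rw [hB]; positivity
  -- split `Λ_M` into near and far sites
  set P := (box d M).filter fun u => Site.supNorm u ≤ 2 * R with hP
  set Q := (box d M).filter fun u => ¬ Site.supNorm u ≤ 2 * R with hQ
  have hsplit : ∑ u ∈ box d M, T u ^ 4 = ∑ u ∈ P, T u ^ 4 + ∑ u ∈ Q, T u ^ 4 :=
    (Finset.sum_filter_add_sum_filter_not _ _ _).symm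
  -- near sites
  have hnear : ∑ u ∈ P, T u ^ 4 ≤ #(box d (2 * R)) * χ₃ ^ 4 := by
    calc ∑ u ∈ P, T u ^ 4 ≤ ∑ _u ∈ P, χ₃ ^ 4 := by
          refine Finset.sum_le_sum fun u hu => ?_
          have hu2 : Site.supNorm u ≤ 2 * R := (Finset.mem_filter.1 hu).2
          exact pow_le_pow_left₀ (hT0 u) (sum_shift_le_sum_box_of_near hS0 hu2) 4
      _ = #P * χ₃ ^ 4 := by rw [Finset.sum_const, nsmul_eq_mul]
      _ ≤ #(box d (2 * R)) * χ₃ ^ 4 := by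
          gcongr
          exact fun u hu => mem_box_iff_supNorm_le.2 (Finset.mem_filter.1 hu).2
  -- far sites, pointwise
  have hfar_pt : ∀ u ∈ Q, T u ^ 4 ≤ A ^ 2 * B ^ 2 / ((Site.supNorm u : ℝ) + 1) ^ (2 * d - 4) := by
    intro u hu
    obtain ⟨huM, hu2⟩ := Finset.mem_filter.1 hu
    have hk : 2 * R + 1 ≤ Site.supNorm u := by omega
    have h1 : T u ≤ A := sum_shift_le_of_far_mms hMMS hm₀ hk rfl
    have h2 : T u ≤ B / ((Site.supNorm u : ℝ) + 1) ^ (d - 2) := by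
      have := sum_shift_le_of_far_decay (S := S) hC₀ hIR hk rfl
      rwa [hB, mul_div_assoc]
    have hk1 : (0 : ℝ) < (Site.supNorm u : ℝ) + 1 := by positivity
    calc T u ^ 4 = T u ^ 2 * T u ^ 2 := by ring
      _ ≤ A ^ 2 * (B / ((Site.supNorm u : ℝ) + 1) ^ (d - 2)) ^ 2 := by
          gcongr
          · exact hT0 u
          · exact hT0 u
      _ = A ^ 2 * B ^ 2 / ((Site.supNorm u : ℝ) + 1) ^ (2 * d - 4) := by
          rw [div_pow, ← pow_mul, mul_div_assoc]
          congr 3; omega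
  -- far sites, shell by shell
  have hfar : ∑ u ∈ Q, T u ^ 4 ≤ A ^ 2 * B ^ 2 * (2 * d * 3 ^ (d - 1) / (2 * (R : ℝ) + 1) ^ (d - 4)) := by
    set t : Finset ℕ := Finset.Ico (2 * R + 1) (M + 1) with ht
    have hmaps : ∀ u ∈ Q, Site.supNorm u ∈ t := by
      intro u hu
      obtain ⟨huM, hu2⟩ := Finset.mem_filter.1 hu
      rw [ht, Finset.mem_Ico]
      have := mem_box_iff_supNorm_le.1 huM
      omega
    have hfib := Finset.sum_fiberwise_of_maps_to (s := Q) (t := t) (g := Site.supNorm)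
      (f := fun u => A ^ 2 * B ^ 2 / ((Site.supNorm u : ℝ) + 1) ^ (2 * d - 4)) hmaps
    calc ∑ u ∈ Q, T u ^ 4
        ≤ ∑ u ∈ Q, A ^ 2 * B ^ 2 / ((Site.supNorm u : ℝ) + 1) ^ (2 * d - 4) :=
          Finset.sum_le_sum hfar_pt
      _ = ∑ k ∈ t, ∑ u ∈ Q with Site.supNorm u = k,
            A ^ 2 * B ^ 2 / ((Site.supNorm u : ℝ) + 1) ^ (2 * d - 4) := hfib.symm
      _ = ∑ k ∈ t, (#(Q.filter fun u => Site.supNorm u = k) : ℝ) *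
            (A ^ 2 * B ^ 2 / ((k : ℝ) + 1) ^ (2 * d - 4)) := by
          refine Finset.sum_congr rfl fun k _ => ?_
          rw [Finset.sum_congr rfl fun u hu => by rw [(Finset.mem_filter.1 hu).2],
            Finset.sum_const, nsmul_eq_mul]
      _ ≤ ∑ k ∈ t, (#(sphere d k) : ℝ) * (A ^ 2 * B ^ 2 / ((k : ℝ) + 1) ^ (2 * d - 4)) := by
          refine Finset.sum_le_sum fun k _ => ?_
          gcongr
          exact fun u hu => mem_sphere.2 (Finset.mem_filter.1 hu).2
      _ = A ^ 2 * B ^ 2 * ∑ k ∈ t, (#(sphere d k) : ℝ) / ((k : ℝ) + 1) ^ (2 * d - 4) := by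
          rw [Finset.mul_sum]
          refine Finset.sum_congr rfl fun k _ => ?_
          ring
      _ ≤ A ^ 2 * B ^ 2 * (2 * d * 3 ^ (d - 1) / ((2 * R + 1 : ℕ) : ℝ) ^ (d - 4)) := by
          gcongr
          exact sum_Ico_card_sphere_div_pow_le hd (by omega) (M + 1)
      _ = A ^ 2 * B ^ 2 * (2 * d * 3 ^ (d - 1) / (2 * (R : ℝ) + 1) ^ (d - 4)) := by
          push_cast; ring
  -- conclusion
  rw [hsplit]
  refine add_le_add hnear (hfar.trans (le_of_eq ?_))
  rw [hA, hB]
  ring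

end LatticeSums

/-! ### B. The critical two-point function and the tree diagram bound in a box -/

section Ising

/-- **The infrared bound at `β_c` in sup-norm form** (a theorem of the tree,
`twoPointFree_criticalBeta_upper_holds`: `⟨σ₀σ_v⟩^∅_{β_c} ≤ C ‖v‖^{-(d-2)}`, `d ≥ 3`;
Fröhlich–Simon–Spencer 1976 with the Messager–Miracle-Solé averaging, Duminil-Copin 2019
Thm. 4.8): there is `C₀ ≥ 0` with `⟨σ₀σ_v⟩^∅_{β_c} ≤ C₀ / ‖v‖_∞^{d-2}` for `v ≠ 0`. [cite: DuminilCopin2019, Thm. 4.8 (upper bound), §4.4] [cite: AizenmanDuminilCopinAnnals2021, arXiv:1912.07973 §1.3 (Infrared Bound, p. 6)] -/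
theorem twoPointFree_criticalBeta_le_div_pow (hd : 3 ≤ d) :
    ∃ C₀ : ℝ, 0 ≤ C₀ ∧ ∀ v : Site d, v ≠ 0 →
      twoPointFree d (criticalBeta d) v ≤ C₀ / (Site.supNorm v : ℝ) ^ (d - 2) := by
  obtain ⟨C, hC⟩ := twoPointFree_criticalBeta_upper_holds (d := d) hd
  refine ⟨|C|, abs_nonneg C, fun v hv => ?_⟩
  have h := hC v hv
  have hk : 1 ≤ Site.supNorm v := by
    by_contra h0
    exact hv (Site.supNorm_eq_zero_iff.1 (by omega))
  have hk0 : (0 : ℝ) ≤ (Site.supNorm v : ℝ) := Nat.cast_nonneg _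
  have he : ((d : ℝ) - 2) = ((d - 2 : ℕ) : ℝ) := by
    rw [Nat.cast_sub (by omega : 2 ≤ d), Nat.cast_ofNat]
  rw [Site.norm_eq_supNorm, he, Real.rpow_neg hk0, Real.rpow_natCast] at h
  calc twoPointFree d (criticalBeta d) v ≤ C * ((Site.supNorm v : ℝ) ^ (d - 2))⁻¹ := h
    _ ≤ |C| * ((Site.supNorm v : ℝ) ^ (d - 2))⁻¹ :=
        mul_le_mul_of_nonneg_right (le_abs_self C) (by positivity)
    _ = |C| / (Site.supNorm v : ℝ) ^ (d - 2) := by rw [div_eq_mul_inv]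

/-- The two-point function of a translation-invariant state with the free correlations is
`⟨σ_aσ_b⟩_μ = ⟨σ₀σ_{b-a}⟩^∅_{β,0}` (Friedli–Velenik 2017, Exercise 3.16 / Thm. 3.17).
[cite: FriedliVelenik2017, Exercise 3.16 and proof of Thm. 3.17 (p. 114)] -/
theorem integral_spinAt_mul_spinAt_eq_twoPointFree {β : ℝ} {μ : Measure (SpinConfig (Site d))}
    [IsProbabilityMeasure μ] (hTI : IsTranslationInvariantMeasure μ)
    (hcorr : ∀ A : Finset (Site d), spinCorr μ A = freeCorr d β 0 A) (a b : Site d) :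
    ∫ σ, spinAt a σ * spinAt b σ ∂μ = twoPointFree d β (b - a) := by
  classical
  rw [integral_spinAt_mul_spinAt_translate μ hTI a b]
  by_cases hv : b - a = 0
  · rw [hv, twoPointFree_zero]; simp
  · have hpair : ∀ σ, spinAt 0 σ * spinAt (b - a) σ = spinProduct {0, b - a} σ := fun σ => by
      rw [spinProduct, Finset.prod_pair (Ne.symm hv)]
    simp_rw [hpair]
    change spinCorr μ {0, b - a} = _
    rw [hcorr, twoPointFree_eq_freeCorr β hv]

/-- **The tree diagram bound smeared over a box, in finite volume** (the finite-graph tree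
diagram bound — Aizenman 1982, CDM 2020 Lemma 8.1/(8.2) — in the free box `Λ_M`, i.e. the tree
theorem `Literature.Probability.LatticeModels.treeDiagramBound_freeFinset`, with the
finite-volume two-point functions dominated by the infinite-volume free ones,
`⟨σ_uσ_x⟩^∅_{Λ_M} ≤ ⟨σ₀σ_{x-u}⟩^∅_β`, and the sum over `x ∈ Λ_R⁴` exchanged with the sum
over `u`): `∑_{x ∈ Λ_R⁴} |U₄^{Λ_M}(x)| ≤ 2 ∑_{u ∈ Λ_M} (∑_{a ∈ Λ_R} ⟨σ₀σ_{a-u}⟩^∅_β)⁴`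
(Panis 2023, proof of Thm 5.5, first display of the bound on (1); Aizenman CDM 2020 (8.2)–(8.5)).
The hypothesis `treeDiagramBound` (the finite-graph named fact, discharged in the tree by
`treeDiagramBound_holds`) is no longer used by the proof; it is retained only to keep the
signature that the callers apply positionally.
[cite: AizenmanCDM2020, Lemma 8.1 and eqs. (8.2), (8.5)] [cite: Panis2023Triviality, proof of Thm. 5.5, bound on (1) (p. 21)] -/
theorem sum_abs_connectedFour_box_le_of_treeDiagramBound (_hTB : treeDiagramBound)
    {β : ℝ} (hβ : 0 ≤ β) {R M : ℕ} (hRM : R ≤ M) :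
    ∑ x ∈ Fintype.piFinset (fun _ : Fin 4 => box d R),
        |connectedFour (isingMeasure (zdGraph d) (box d M) β 0 .free) spinAt x| ≤
      2 * ∑ u ∈ box d M, (∑ a ∈ box d R, twoPointFree d β (a - u)) ^ 4 := by
  classical
  have hgks : ∀ {Λ A : Finset (Site d)} {β h : ℝ} {bc : BoundaryCondition (Site d)},
      gks_one (zdGraph d) (Λ := Λ) (A := A) (β := β) (h := h) (bc := bc) :=
    GKSInequalities.gks_one_holds (zdGraph d)
  have hlim : hasBoxLimit_isingCorr_free d := hasBoxLimit_isingCorr_free_holds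
  have hmono : isingCorr_free_mono_volume (d := d) := isingCorr_free_mono_volume_holds
  have htr : isingTwoPoint_free_translate (d := d) := isingTwoPoint_free_translate_holds
  have hsub : box d R ⊆ box d M := box_mono d hRM
  set S : Site d → ℝ := twoPointFree d β with hS
  have hpt : ∀ x ∈ Fintype.piFinset (fun _ : Fin 4 => box d R),
      |connectedFour (isingMeasure (zdGraph d) (box d M) β 0 .free) spinAt x| ≤
        2 * ∑ u ∈ box d M, ∏ j, S (x j - u) := by
    intro x hx
    have hxM : ∀ i, x i ∈ box d M := fun i => hsub (Fintype.mem_piFinset.1 hx i)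
    refine (treeDiagramBound_freeFinset hβ (box d M) x hxM).trans ?_
    refine mul_le_mul_of_nonneg_left (Finset.sum_le_sum fun u hu => ?_) zero_le_two
    exact Finset.prod_le_prod (fun j _ => isingTwoPoint_free_nonneg hgks hβ hu (hxM j))
      fun j _ => isingTwoPoint_free_le_twoPointFree_sub hmono hlim htr hβ hu (hxM j)
  calc ∑ x ∈ Fintype.piFinset (fun _ : Fin 4 => box d R),
        |connectedFour (isingMeasure (zdGraph d) (box d M) β 0 .free) spinAt x|
      ≤ ∑ x ∈ Fintype.piFinset (fun _ : Fin 4 => box d R), 2 * ∑ u ∈ box d M, ∏ j, S (x j - u) :=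
        Finset.sum_le_sum hpt
    _ = 2 * ∑ u ∈ box d M, ∑ x ∈ Fintype.piFinset (fun _ : Fin 4 => box d R), ∏ j, S (x j - u) := by
        rw [← Finset.mul_sum, Finset.sum_comm]
    _ = 2 * ∑ u ∈ box d M, (∑ a ∈ box d R, S (a - u)) ^ 4 := by
        congr 1
        refine Finset.sum_congr rfl fun u _ => ?_
        rw [← Fin.prod_const 4 (∑ a ∈ box d R, S (a - u)), Finset.prod_univ_sum]

/-- **Passage to the infinite volume**: a bound on `∑_{x ∈ Λ_R⁴} |U₄^{Λ_M}(x)|` uniform in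
`M ≥ R` passes to the state `μ` with the free correlations (box limits of the free state,
`tendsto_connectedFour_box_free`). [cite: FriedliVelenik2017, Exercise 3.16] -/
theorem sum_abs_connectedFour_le_of_forall_box {β : ℝ} (hβ : 0 ≤ β)
    {μ : Measure (SpinConfig (Site d))}
    (hcorr : ∀ A : Finset (Site d), spinCorr μ A = freeCorr d β 0 A) {R : ℕ} {B : ℝ}
    (hB : ∀ M : ℕ, R ≤ M →
      ∑ x ∈ Fintype.piFinset (fun _ : Fin 4 => box d R),
        |connectedFour (isingMeasure (zdGraph d) (box d M) β 0 .free) spinAt x| ≤ B) :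
    ∑ x ∈ Fintype.piFinset (fun _ : Fin 4 => box d R), |connectedFour μ spinAt x| ≤ B := by
  have hconv : Tendsto (fun M : ℕ => ∑ x ∈ Fintype.piFinset (fun _ : Fin 4 => box d R),
      |connectedFour (isingMeasure (zdGraph d) (box d M) β 0 .free) spinAt x|) atTop
      (𝓝 (∑ x ∈ Fintype.piFinset (fun _ : Fin 4 => box d R), |connectedFour μ spinAt x|)) :=
    tendsto_finsetSum _ fun x _ => (tendsto_connectedFour_box_free hβ hcorr x).abs
  refine le_of_tendsto hconv ?_
  filter_upwards [eventually_ge_atTop R] with M hM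
  exact hB M hM

/-! ### C. The `d > 4` bound on the normalised sum of `|U₄|` at `β_c` -/

/-- **Aizenman's `d > 4` bound on the normalised sum of the four-point Ursell function at
criticality, from the finite-graph tree diagram bound** (Aizenman, CDM 2020, §8.1 eq. (8.5):
"the combination of the two bounds [tree diagram bound (8.2) and infrared bound (8.4)] yields
for the nearest neighbor Ising model the estimate `R_L(β) ≤ C L^d (χ_L)⁴/(Σ_L)² ≤ C/L^{d-4}`";
Panis 2023, Thm 5.5 / proof pp. 21–22, `S(β,L,f) ≤ C … r_f^γ L^{4-d}`; originally Aizenman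
1982 and Fröhlich 1982). For `d ≥ 5` there is `C` such that for the translation-invariant
state `μ` with the free correlations at `β_c` (the critical state: `m*(β_c) = 0`), all real
`L ≥ 1`, `r ≥ 1`: `Σ_L⁻² ∑_{x ∈ Λ_{rL}⁴} |U₄^μ(x)| ≤ C r^{4d} / L^{d-4}`
(`ursellFourSum μ L r`). Inputs: the named fact `treeDiagramBound` (finite graphs) and the
tree's theorems — the infrared bound at `β_c` (`twoPointFree_criticalBeta_upper_holds`), the
Messager–Miracle-Solé comparison (`twoPointFree_le_of_mul_supNorm_le`), Griffiths' first
inequality and the box limits of the free state; the lower bound `Σ_L ≥ |Λ_{m}| χ_m`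
(`card_mul_sum_box_le_blockSpinVariance`). The exponent `4d` of `r` is not optimised.
[cite: AizenmanCDM2020, §8.1 eq. (8.5)] [cite: Panis2023Triviality, Thm. 5.5 and its proof (pp. 21–22)] [cite: AizenmanDuminilCopinAnnals2021, arXiv:1912.07973 §1.3 (tree diagram bound, infrared bound, O(L^{4-d}))] [cite: AizenmanCMP1982] [cite: FrohlichTrivialityNPB1982] -/
theorem ursellFourSum_criticalBeta_le_of_treeDiagramBound (hTB : treeDiagramBound)
    (hd : 5 ≤ d) :
    ∃ C : ℝ, 0 < C ∧ ∀ (μ : Measure (SpinConfig (Site d))) [IsProbabilityMeasure μ],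
      IsTranslationInvariantMeasure μ →
      (∀ A : Finset (Site d), spinCorr μ A = freeCorr d (criticalBeta d) 0 A) →
      ∀ (L r : ℝ), 1 ≤ L → 1 ≤ r →
        ursellFourSum μ L r ≤ C * r ^ (4 * d) / L ^ (d - 4) := by
  classical
  have hd2 : 2 ≤ d := by omega
  have hd1 : 1 ≤ d := by omega
  have hdR : (1 : ℝ) ≤ d := by exact_mod_cast hd1
  have hdne : (d : ℝ) ≠ 0 := by positivity
  have hβ : 0 ≤ criticalBeta d := criticalBeta_nonneg d
  -- inputs: the infrared bound, Griffiths I, Messager–Miracle-Solé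
  obtain ⟨C₀, hC₀, hIR⟩ := twoPointFree_criticalBeta_le_div_pow (d := d) (by omega)
  set S : Site d → ℝ := twoPointFree d (criticalBeta d) with hSdef
  have hgks : ∀ {Λ A : Finset (Site d)} {β h : ℝ} {bc : BoundaryCondition (Site d)},
      gks_one (zdGraph d) (Λ := Λ) (A := A) (β := β) (h := h) (bc := bc) :=
    GKSInequalities.gks_one_holds (zdGraph d)
  have hlim : hasBoxLimit_isingCorr_free d := hasBoxLimit_isingCorr_free_holds
  have hS0 : ∀ v, 0 ≤ S v := fun v => twoPointFree_nonneg hlim hgks hβ v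
  have hS00 : S 0 = 1 := twoPointFree_zero d (criticalBeta d)
  have hMMS : ∀ z w : Site d, d * Site.supNorm w ≤ Site.supNorm z → S z ≤ S w :=
    fun z w h => twoPointFree_le_of_mul_supNorm_le hβ hd1 h
  -- constants
  set C₁ : ℝ := 1 + 2 * d * 3 ^ (d - 1) * C₀ with hC₁
  have hC₁0 : 0 ≤ C₁ := by positivity
  set Kn : ℝ := 2 * (5 : ℝ) ^ d * 4 ^ 5 * ((56 : ℝ) * d ^ 2) ^ (2 * d) *
    ((4 : ℝ) * d) ^ (2 * d) * C₁ ^ 2 with hKn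
  set Kf : ℝ := 2 * (3 : ℝ) ^ (4 * d) * (C₀ * 2 ^ (d - 2)) ^ 2 * ((4 : ℝ) * d) ^ (4 * d) *
    (2 * d * 3 ^ (d - 1)) with hKf
  have hKn0 : 0 ≤ Kn := by positivity
  have hKf0 : 0 ≤ Kf := by positivity
  refine ⟨Kn + Kf + 1, by positivity, ?_⟩
  intro μ _ hTI hcorr L r hL hr
  -- box sums of `S`
  set χ : ℕ → ℝ := fun m => ∑ v ∈ box d m, S v with hχ
  have hχ0 : ∀ m, 0 ≤ χ m := fun m => Finset.sum_nonneg fun v _ => hS0 v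
  have hχ1 : ∀ m, 1 ≤ χ m := fun m => one_le_sum_box hS0 hS00 m
  have hχsq : ∀ m : ℕ, χ m ≤ C₁ * ((m : ℝ) + 1) ^ 2 := fun m => by
    have h := sum_box_le_sq_of_decay (S := S) hd2 (by rw [hS00]; exact zero_le_one) hC₀ hIR m
    rw [hS00, ← hC₁] at h
    exact h
  -- integer scales `n = ⌊L⌋`, `R = ⌊rL⌋`, `m₀ = n/(2d)`, `m₁ = (m₀+1)/d`
  have hL0 : 0 ≤ L := by linarith
  have hLpos : 0 < L := by linarith
  have hLne : L ≠ 0 := hLpos.ne'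
  have hr0 : 0 ≤ r := by linarith
  set n : ℕ := ⌊L⌋₊ with hn
  have hn1 : 1 ≤ n := Nat.le_floor (by exact_mod_cast hL)
  have hnL : (n : ℝ) ≤ L := Nat.floor_le hL0
  have hLn : L < n + 1 := Nat.lt_floor_add_one L
  have hn1' : (1 : ℝ) ≤ n := by exact_mod_cast hn1
  have hL2n : L ≤ 2 * n := by linarith
  have hrL1 : 1 ≤ r * L := one_le_mul_of_one_le_of_one_le hr hL
  have hLrL : L ≤ r * L := le_mul_of_one_le_left hL0 hr
  set R : ℕ := ⌊r * L⌋₊ with hR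
  have hR1 : 1 ≤ R := Nat.le_floor (by exact_mod_cast hrL1)
  have hR1' : (1 : ℝ) ≤ R := by exact_mod_cast hR1
  have hRrL : (R : ℝ) ≤ r * L := Nat.floor_le (by linarith)
  have hrLR : r * L < R + 1 := Nat.lt_floor_add_one _
  have hnR : n ≤ R := Nat.floor_le_floor hLrL
  have hboxL : latticeBox d L = box d n := latticeBox_eq_box hL0
  have hboxR : latticeBox d (r * L) = box d R := latticeBox_eq_box (by linarith)
  set m₀ : ℕ := n / (2 * d) with hm₀
  have hdm₀n : 2 * d * m₀ ≤ n := Nat.mul_div_le n (2 * d)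
  have hm₀le : m₀ ≤ 2 * d * m₀ := Nat.le_mul_of_pos_left _ (by positivity)
  have h2m₀ : 2 * m₀ ≤ n := by
    calc 2 * m₀ ≤ 2 * (d * m₀) := Nat.mul_le_mul_left 2 (Nat.le_mul_of_pos_left _ (by omega))
      _ = 2 * d * m₀ := by ring
      _ ≤ n := hdm₀n
  have hdm₀ : d * m₀ ≤ R + 1 := by
    calc d * m₀ ≤ 2 * (d * m₀) := Nat.le_mul_of_pos_left _ two_pos
      _ = 2 * d * m₀ := by ring
      _ ≤ n := hdm₀n
      _ ≤ R + 1 := hnR.trans (Nat.le_succ R)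
  have hm₀R : m₀ ≤ 3 * R :=
    hm₀le.trans (hdm₀n.trans (hnR.trans (Nat.le_mul_of_pos_left R (by norm_num))))
  set m₁ : ℕ := (m₀ + 1) / d with hm₁
  have hbox₀ : L / (4 * d) ≤ 2 * (m₀ : ℝ) + 1 := by
    have h1 : ((n : ℕ) : ℝ) < ((2 * d * (m₀ + 1) : ℕ) : ℝ) := by
      exact_mod_cast Nat.lt_mul_div_succ n (by positivity)
    push_cast at h1
    have hm : (0 : ℝ) ≤ m₀ := Nat.cast_nonneg m₀
    rw [div_le_iff₀ (by positivity)]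
    calc L ≤ 2 * n := hL2n
      _ ≤ 2 * (2 * d * ((m₀ : ℝ) + 1)) := by linarith
      _ = (4 * d) * ((m₀ : ℝ) + 1) := by ring
      _ ≤ (4 * d) * (2 * (m₀ : ℝ) + 1) := by gcongr; linarith
      _ = (2 * (m₀ : ℝ) + 1) * (4 * d) := by ring
  have hbox₁ : L / (8 * d ^ 2) ≤ 2 * (m₁ : ℝ) + 1 := by
    have h1 : ((m₀ + 1 : ℕ) : ℝ) < ((d * (m₁ + 1) : ℕ) : ℝ) := by
      exact_mod_cast Nat.lt_mul_div_succ (m₀ + 1) (by omega)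
    push_cast at h1
    have hm : (0 : ℝ) ≤ m₁ := Nat.cast_nonneg m₁
    have h0 : L ≤ (2 * (m₀ : ℝ) + 1) * (4 * d) := (div_le_iff₀ (by positivity)).1 hbox₀
    rw [div_le_iff₀ (by positivity)]
    calc L ≤ (2 * (m₀ : ℝ) + 1) * (4 * d) := h0
      _ ≤ (2 * ((m₀ : ℝ) + 1)) * (4 * d) := by gcongr; linarith
      _ = (8 * d) * ((m₀ : ℝ) + 1) := by ring
      _ ≤ (8 * d) * (d * ((m₁ : ℝ) + 1)) := by gcongr
      _ ≤ (8 * d) * (d * (2 * (m₁ : ℝ) + 1)) := by gcongr; linarith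
      _ = (2 * (m₁ : ℝ) + 1) * (8 * d ^ 2) := by ring
  -- cardinalities of the boxes against powers of `L`, `rL`
  have hcb₀ : (L / (4 * d)) ^ d ≤ #(box d m₀) := by
    rw [card_box]; push_cast
    exact pow_le_pow_left₀ (by positivity) hbox₀ d
  have hcb₁ : (L / (8 * d ^ 2)) ^ d ≤ #(box d m₁) := by
    rw [card_box]; push_cast
    exact pow_le_pow_left₀ (by positivity) hbox₁ d
  have hcb₀pos : 0 < (L / (4 * d)) ^ d := by positivity
  have hcb₁pos : 0 < (L / (8 * d ^ 2)) ^ d := by positivity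
  have hcbR : (#(box d R) : ℝ) ≤ (3 * (r * L)) ^ d := by
    rw [card_box]; push_cast
    exact pow_le_pow_left₀ (by positivity) (by linarith) d
  have hcb2R : (#(box d (2 * R)) : ℝ) ≤ (5 * (r * L)) ^ d := by
    rw [card_box]; push_cast
    exact pow_le_pow_left₀ (by positivity) (by linarith) d
  have hcb3R : (#(box d (3 * R)) : ℝ) ≤ (7 * (r * L)) ^ d := by
    rw [card_box]; push_cast
    exact pow_le_pow_left₀ (by positivity) (by linarith) d
  have hcm₀pos : (0 : ℝ) < #(box d m₀) := by rw [card_box]; positivity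
  have hcm₀ne : (#(box d m₀) : ℝ) ≠ 0 := hcm₀pos.ne'
  have hcm₁pos : (0 : ℝ) < #(box d m₁) := by rw [card_box]; positivity
  -- the two-point function of `μ` and the denominator `Σ_L ≥ |Λ_{m₀}| χ_{m₀}`
  have hS : ∀ a b, ∫ σ, spinAt a σ * spinAt b σ ∂μ = S (b - a) :=
    integral_spinAt_mul_spinAt_eq_twoPointFree hTI hcorr
  set D : ℝ := (#(box d m₀) : ℝ) * χ m₀ with hD
  have hden : D ≤ blockSpinVariance μ L :=
    card_mul_sum_box_le_blockSpinVariance μ hS hS0 hboxL h2m₀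
  have hχm₀pos : 0 < χ m₀ := by linarith [hχ1 m₀]
  have hD0 : 0 < D := mul_pos hcm₀pos hχm₀pos
  have hDne : D ≠ 0 := hD0.ne'
  -- the numerator
  set ρ : ℝ := (#(box d (3 * R)) : ℝ) / #(box d m₁) with hρ
  have hρ0' : 0 ≤ ρ := div_nonneg (Nat.cast_nonneg _) (Nat.cast_nonneg _)
  set cF : ℝ := (C₀ * 2 ^ (d - 2)) ^ 2 with hcF
  have hcF0 : 0 ≤ cF := sq_nonneg _
  have hF0 : (0 : ℝ) ≤ 2 * d * 3 ^ (d - 1) / (2 * (R : ℝ) + 1) ^ (d - 4) := by positivity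
  set F : ℝ := 2 * d * 3 ^ (d - 1) / (2 * (R : ℝ) + 1) ^ (d - 4) with hFdef
  have hF'0 : (0 : ℝ) ≤ 2 * d * 3 ^ (d - 1) / L ^ (d - 4) := by positivity
  set F' : ℝ := 2 * d * 3 ^ (d - 1) / L ^ (d - 4) with hF'def
  have hFF' : F ≤ F' := by
    refine div_le_div_of_nonneg_left (by positivity) (by positivity) ?_
    exact pow_le_pow_left₀ hL0 (by linarith) _
  set Near : ℝ := #(box d (2 * R)) * χ (3 * R) ^ 4 with hNear
  set Far : ℝ := (#(box d R) : ℝ) ^ 4 * (χ m₀ / #(box d m₀)) ^ 2 * cF * F with hFar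
  have hnum : ∑ x ∈ Fintype.piFinset (fun _ : Fin 4 => latticeBox d (r * L)),
      |connectedFour μ spinAt x| ≤ 2 * (Near + Far) := by
    rw [hboxR]
    refine sum_abs_connectedFour_le_of_forall_box hβ hcorr fun M hM => ?_
    refine (sum_abs_connectedFour_box_le_of_treeDiagramBound hTB hβ hM).trans ?_
    exact mul_le_mul_of_nonneg_left (sum_box_shiftSum_pow_four_le hd hS0 hMMS hC₀ hIR hdm₀ M)
      zero_le_two
  have hNear0 : 0 ≤ Near := mul_nonneg (Nat.cast_nonneg _) (pow_nonneg (hχ0 _) 4)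
  have hFar0 : 0 ≤ Far :=
    mul_nonneg (mul_nonneg (mul_nonneg (pow_nonneg (Nat.cast_nonneg _) 4) (sq_nonneg _)) hcF0) hF0
  have hNF0 : 0 ≤ 2 * (Near + Far) := mul_nonneg zero_le_two (add_nonneg hNear0 hFar0)
  have hratio : ursellFourSum μ L r ≤ 2 * (Near + Far) / D ^ 2 := by
    rw [ursellFourSum]
    calc _ ≤ 2 * (Near + Far) / blockSpinVariance μ L ^ 2 :=
          div_le_div_of_nonneg_right hnum (sq_nonneg _)
      _ ≤ 2 * (Near + Far) / D ^ 2 :=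
          div_le_div_of_nonneg_left hNF0 (pow_pos hD0 2) (pow_le_pow_left₀ hD0.le hden 2)
  -- near part
  have hρ1 : 1 + ρ ≤ 2 * ((56 : ℝ) * d ^ 2 * r) ^ d := by
    have hρle : ρ ≤ ((56 : ℝ) * d ^ 2 * r) ^ d := by
      calc ρ ≤ (7 * (r * L)) ^ d / #(box d m₁) := div_le_div_of_nonneg_right hcb3R hcm₁pos.le
        _ ≤ (7 * (r * L)) ^ d / (L / (8 * d ^ 2)) ^ d :=
            div_le_div_of_nonneg_left (by positivity) hcb₁pos hcb₁
        _ = ((56 : ℝ) * d ^ 2 * r) ^ d := by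
            rw [← div_pow]
            congr 1
            field_simp
            ring
    have hone : (1 : ℝ) ≤ ((56 : ℝ) * d ^ 2 * r) ^ d := by
      refine one_le_pow₀ ?_
      have hdsq : (1 : ℝ) ≤ (d : ℝ) ^ 2 := one_le_pow₀ hdR
      calc (1 : ℝ) ≤ (d : ℝ) ^ 2 := hdsq
        _ ≤ (d : ℝ) ^ 2 * r := le_mul_of_one_le_right (by positivity) hr
        _ ≤ 56 * ((d : ℝ) ^ 2 * r) := le_mul_of_one_le_left (by positivity) (by norm_num)
        _ = 56 * (d : ℝ) ^ 2 * r := by ring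
    linarith
  have hρ0 : 0 ≤ 1 + ρ := by linarith
  have hL2d : L ^ (2 * d) = L ^ (d + 4) * L ^ (d - 4) := by
    rw [← pow_add]; congr 1; omega
  have hnear : 2 * Near ≤ (Kn * r ^ (3 * d + 4) / L ^ (d - 4)) * D ^ 2 := by
    have hχ3a : χ (3 * R) ≤ C₁ * (4 * (r * L)) ^ 2 := by
      refine (hχsq (3 * R)).trans ?_
      push_cast
      gcongr
      linarith
    have hχ3b : χ (3 * R) ≤ χ m₀ * (1 + ρ) := sum_box_le_sum_box_mul hS0 hMMS hd2 hm₀R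
    have h4 : χ (3 * R) ^ 4 ≤ (C₁ * (4 * (r * L)) ^ 2) ^ 2 * (χ m₀ * (1 + ρ)) ^ 2 := by
      rw [show χ (3 * R) ^ 4 = χ (3 * R) ^ 2 * χ (3 * R) ^ 2 by ring]
      exact mul_le_mul (pow_le_pow_left₀ (hχ0 _) hχ3a 2) (pow_le_pow_left₀ (hχ0 _) hχ3b 2)
        (sq_nonneg _) (sq_nonneg _)
    have haux : ((L / (4 * d)) ^ d) ^ 2 = L ^ (d + 4) * L ^ (d - 4) / ((4 : ℝ) * d) ^ (2 * d) := by
      rw [← pow_mul, div_pow, mul_comm d 2, hL2d]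
    have ha0 : 0 ≤ (5 * (r * L)) ^ d := pow_nonneg (by positivity) d
    have hab0 : 0 ≤ 2 * (5 * (r * L)) ^ d * (C₁ * (4 * (r * L)) ^ 2) ^ 2 :=
      mul_nonneg (mul_nonneg zero_le_two ha0) (sq_nonneg _)
    have hX : 2 * (5 * (r * L)) ^ d * (C₁ * (4 * (r * L)) ^ 2) ^ 2 * (1 + ρ) ^ 2 ≤
        2 * (5 * (r * L)) ^ d * (C₁ * (4 * (r * L)) ^ 2) ^ 2 *
          (2 * ((56 : ℝ) * d ^ 2 * r) ^ d) ^ 2 :=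
      mul_le_mul_of_nonneg_left (pow_le_pow_left₀ hρ0 hρ1 2) hab0
    have hX0 : 0 ≤ 2 * (5 * (r * L)) ^ d * (C₁ * (4 * (r * L)) ^ 2) ^ 2 *
        (2 * ((56 : ℝ) * d ^ 2 * r) ^ d) ^ 2 := mul_nonneg hab0 (sq_nonneg _)
    have hden₂ : ((L / (4 * d)) ^ d) ^ 2 ≤ (#(box d m₀) : ℝ) ^ 2 :=
      pow_le_pow_left₀ hcb₀pos.le hcb₀ 2
    calc 2 * Near = 2 * ((#(box d (2 * R)) : ℝ) * χ (3 * R) ^ 4) := by rw [hNear]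
      _ ≤ 2 * ((5 * (r * L)) ^ d * ((C₁ * (4 * (r * L)) ^ 2) ^ 2 * (χ m₀ * (1 + ρ)) ^ 2)) :=
          mul_le_mul_of_nonneg_left (mul_le_mul hcb2R h4 (pow_nonneg (hχ0 _) 4) ha0) zero_le_two
      _ = (2 * (5 * (r * L)) ^ d * (C₁ * (4 * (r * L)) ^ 2) ^ 2 * (1 + ρ) ^ 2 /
            (#(box d m₀) : ℝ) ^ 2) * D ^ 2 := by
          rw [hD]; field_simp
      _ ≤ (2 * (5 * (r * L)) ^ d * (C₁ * (4 * (r * L)) ^ 2) ^ 2 *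
            (2 * ((56 : ℝ) * d ^ 2 * r) ^ d) ^ 2 / (#(box d m₀) : ℝ) ^ 2) * D ^ 2 :=
          mul_le_mul_of_nonneg_right (div_le_div_of_nonneg_right hX (sq_nonneg _)) (sq_nonneg _)
      _ ≤ (2 * (5 * (r * L)) ^ d * (C₁ * (4 * (r * L)) ^ 2) ^ 2 *
            (2 * ((56 : ℝ) * d ^ 2 * r) ^ d) ^ 2 / ((L / (4 * d)) ^ d) ^ 2) * D ^ 2 :=
          mul_le_mul_of_nonneg_right (div_le_div_of_nonneg_left hX0 (pow_pos hcb₀pos 2) hden₂)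
            (sq_nonneg _)
      _ = (Kn * r ^ (3 * d + 4) / L ^ (d - 4)) * D ^ 2 := by
          congr 1
          rw [haux, hKn]
          field_simp
          ring
  -- far part
  have hfar : 2 * Far ≤ (Kf * r ^ (4 * d) / L ^ (d - 4)) * D ^ 2 := by
    have haux : ((L / (4 * d)) ^ d) ^ 4 = L ^ (4 * d) / ((4 : ℝ) * d) ^ (4 * d) := by
      rw [← pow_mul, div_pow, mul_comm d 4]
    have hq0 : 0 ≤ (χ m₀ / #(box d m₀)) ^ 2 := sq_nonneg _
    have hp0 : 0 ≤ ((3 * (r * L)) ^ d) ^ 4 := pow_nonneg (pow_nonneg (by positivity) d) 4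
    have hY : (#(box d R) : ℝ) ^ 4 * (χ m₀ / #(box d m₀)) ^ 2 * cF * F ≤
        ((3 * (r * L)) ^ d) ^ 4 * (χ m₀ / #(box d m₀)) ^ 2 * cF * F' :=
      mul_le_mul (mul_le_mul_of_nonneg_right (mul_le_mul_of_nonneg_right
        (pow_le_pow_left₀ (Nat.cast_nonneg _) hcbR 4) hq0) hcF0) hFF' hF0
        (mul_nonneg (mul_nonneg hp0 hq0) hcF0)
    have hZ0 : 0 ≤ 2 * ((3 * (r * L)) ^ d) ^ 4 * cF * F' :=
      mul_nonneg (mul_nonneg (mul_nonneg zero_le_two hp0) hcF0) hF'0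
    have hden₄ : ((L / (4 * d)) ^ d) ^ 4 ≤ (#(box d m₀) : ℝ) ^ 4 :=
      pow_le_pow_left₀ hcb₀pos.le hcb₀ 4
    calc 2 * Far = 2 * ((#(box d R) : ℝ) ^ 4 * (χ m₀ / #(box d m₀)) ^ 2 * cF * F) := by rw [hFar]
      _ ≤ 2 * (((3 * (r * L)) ^ d) ^ 4 * (χ m₀ / #(box d m₀)) ^ 2 * cF * F') :=
          mul_le_mul_of_nonneg_left hY zero_le_two
      _ = (2 * ((3 * (r * L)) ^ d) ^ 4 * cF * F' / (#(box d m₀) : ℝ) ^ 4) * D ^ 2 := by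
          rw [hD]; field_simp
      _ ≤ (2 * ((3 * (r * L)) ^ d) ^ 4 * cF * F' / ((L / (4 * d)) ^ d) ^ 4) * D ^ 2 :=
          mul_le_mul_of_nonneg_right (div_le_div_of_nonneg_left hZ0 (pow_pos hcb₀pos 4) hden₄)
            (sq_nonneg _)
      _ = (Kf * r ^ (4 * d) / L ^ (d - 4)) * D ^ 2 := by
          congr 1
          rw [haux, hKf, hcF, hF'def]
          field_simp
          ring
  -- conclusion
  have hr34 : r ^ (3 * d + 4) ≤ r ^ (4 * d) := pow_le_pow_right₀ hr (by omega)
  have hLd : 0 < L ^ (d - 4) := by positivity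
  have hx0 : 0 ≤ r ^ (4 * d) := pow_nonneg hr0 _
  calc ursellFourSum μ L r ≤ 2 * (Near + Far) / D ^ 2 := hratio
    _ = (2 * Near + 2 * Far) / D ^ 2 := by ring
    _ ≤ ((Kn * r ^ (3 * d + 4) / L ^ (d - 4)) * D ^ 2 + (Kf * r ^ (4 * d) / L ^ (d - 4)) * D ^ 2) /
          D ^ 2 := div_le_div_of_nonneg_right (add_le_add hnear hfar) (sq_nonneg _)
    _ = Kn * r ^ (3 * d + 4) / L ^ (d - 4) + Kf * r ^ (4 * d) / L ^ (d - 4) := by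
          rw [← add_mul, mul_div_assoc, div_self (pow_ne_zero 2 hDne), mul_one]
    _ ≤ Kn * r ^ (4 * d) / L ^ (d - 4) + Kf * r ^ (4 * d) / L ^ (d - 4) :=
          add_le_add (div_le_div_of_nonneg_right
            (mul_le_mul_of_nonneg_left hr34 hKn0) hLd.le) le_rfl
    _ = (Kn * r ^ (4 * d) + Kf * r ^ (4 * d)) / L ^ (d - 4) := by rw [add_div]
    _ ≤ (Kn + Kf + 1) * r ^ (4 * d) / L ^ (d - 4) := by
          refine div_le_div_of_nonneg_right ?_ hLd.le
          calc Kn * r ^ (4 * d) + Kf * r ^ (4 * d)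
              ≤ Kn * r ^ (4 * d) + Kf * r ^ (4 * d) + r ^ (4 * d) := le_add_of_nonneg_right hx0
            _ = (Kn + Kf + 1) * r ^ (4 * d) := by ring

end Ising

/-! ### D. The moment generating functions: the `d > 4` displays from the two finite-graph facts -/

section MGF

variable {d : ℕ}

/-- **The deviation of the critical moment generating function from `1`, ratio form, one
state.** Let `μ` be a DLR state at `(β_c, 0)` with the plus correlations, vanishing odd
correlations, and the two halves of Aizenman's inequality (`PairingLowerBound μ`,
`PairingUpperBound μ`). For `f ∈ C_0` vanishing outside `[-r, r]^d`, `L ≥ 1` and real `z`: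
`|⟨exp[z T_{f,L} - (z²/2)⟨T_{f,L}²⟩]⟩_{β_c} - 1| ≤ exp((z²/2)(⟨T_{|f|,L}²⟩ - ⟨T_{f,L}²⟩)) · 24 ‖f‖_∞⁴ S(μ;L,r) z⁴`
— the printed un-normalised estimate `|⟨e^{zT}⟩ - e^{z²⟨T²⟩/2}| ≤ e^{z²⟨T_{|f|}²⟩/2} C₁ z⁴ ‖f‖⁴_∞ S`
(Aizenman–Duminil-Copin 2021, §6.3, p. 26, third display; Aizenman CDM 2020, (7.9)) divided by
`exp((z²/2)⟨T_{f,L}²⟩)` without discarding the normalisation (sharper than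
`abs_criticalSmearedMGF_sub_one_le_of_pairingBounds`, where `exp(-(z²/2)⟨T_{f,L}²⟩) ≤ 1` is used).
[cite: AizenmanDuminilCopinAnnals2021, §6.3 (p. 26, third display)] [cite: AizenmanCDM2020, §7 eq. (7.9)] -/
theorem abs_criticalSmearedMGF_sub_one_le_ratio_of_pairingBounds
    {μ : Measure (SpinConfig (Site d))} (hμG : μ ∈ isingGibbsMeasures d (criticalBeta d) 0)
    (hμ : ∀ A : Finset (Site d), spinCorr μ A = plusCorr d (criticalBeta d) 0 A)
    (hlow : PairingLowerBound μ) (hup : PairingUpperBound μ)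
    (hodd : ∀ {n : ℕ}, Odd n → ∀ x : Fin n → Site d, ∫ σ, ∏ i, spinAt (x i) σ ∂μ = 0)
    {f : EuclideanSpace ℝ (Fin d) → ℝ} (hf : Continuous f) {r : ℝ}
    (hfr : ∀ x, f x ≠ 0 → ∀ i, |x i| ≤ r) {L : ℕ} (hL : 1 ≤ L) (z : ℝ) :
    |criticalSmearedMGF d f L z - 1| ≤
      Real.exp (z ^ 2 / 2 * ((∫ σ, normalizedField μ L (fun x => |f x|) σ ^ 2 ∂μ) -
        ∫ σ, normalizedField μ L f σ ^ 2 ∂μ)) *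
        (24 * (⨆ x, |f x|) ^ 4 * ursellFourSum μ L r * z ^ 4) := by
  haveI : IsProbabilityMeasure μ := hμG.1
  have hLpos : (0 : ℝ) < (L : ℝ) := Nat.cast_pos.mpr (by omega)
  have hLne : ((L : ℕ) : ℝ) ≠ 0 := hLpos.ne'
  have hfar : ∀ x, (fun y => |f y|) x ≠ 0 → ∀ i, |x i| ≤ r := fun x hx =>
    hfr x (abs_ne_zero.mp hx)
  set E : ℝ := 3 / 2 * (⨆ x, |f x|) ^ 4 * ursellFourSum μ L r with hE_def
  have hE : 0 ≤ E :=
    mul_nonneg (mul_nonneg (by norm_num) (pow_nonneg (iSup_abs_nonneg f) 4))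
      (ursellFourSum_nonneg μ L r)
  have key := abs_mgf_sub_exp_le_of_moment_bounds (μ := μ) (X := normalizedField μ L f)
    (Y := normalizedField μ L fun x => |f x|) (measurable_normalizedField μ hLne hfr)
    (abs_normalizedField_le μ hLne hfr) hE ?_ ?_ ?_ z
  · set V : ℝ := ∫ σ, normalizedField μ L f σ ^ 2 ∂μ with hV
    set W : ℝ := ∫ σ, normalizedField μ L (fun x => |f x|) σ ^ 2 ∂μ with hW
    rw [criticalSmearedMGF_eq hμ hfr hL z]
    have hpos : 0 < Real.exp (z ^ 2 / 2 * V) := Real.exp_pos _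
    have h1 : Real.exp (-(z ^ 2 / 2 * V)) * (∫ σ, Real.exp (z * normalizedField μ L f σ) ∂μ) - 1 =
        Real.exp (-(z ^ 2 / 2 * V)) *
          ((∫ σ, Real.exp (z * normalizedField μ L f σ) ∂μ) - Real.exp (z ^ 2 / 2 * V)) := by
      rw [mul_sub, Real.exp_neg, inv_mul_cancel₀ hpos.ne']
    rw [h1, abs_mul, Real.abs_exp]
    calc Real.exp (-(z ^ 2 / 2 * V)) *
          |(∫ σ, Real.exp (z * normalizedField μ L f σ) ∂μ) - Real.exp (z ^ 2 / 2 * V)|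
        ≤ Real.exp (-(z ^ 2 / 2 * V)) * (16 * E * z ^ 4 * Real.exp (z ^ 2 / 2 * W)) :=
          mul_le_mul_of_nonneg_left key (Real.exp_pos _).le
      _ = Real.exp (z ^ 2 / 2 * (W - V)) * (16 * E * z ^ 4) := by
          have e : -(z ^ 2 / 2 * V) + z ^ 2 / 2 * W = z ^ 2 / 2 * (W - V) := by ring
          rw [← e, Real.exp_add]
          ring
      _ = _ := by rw [hE_def]; ring
  · intro n hn
    calc _ ≤ _ := abs_integral_normalizedField_pow_sub_le_of_pairingBounds hlow hup hLpos hf hfr hn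
      _ = _ := by rw [hE_def]; ring
  · intro n
    exact integral_normalizedField_pow_le_of_pairingLowerBound hlow hLpos
      (hasCompactSupport_of_cube hfar) (fun x => abs_nonneg _) n
  · intro n
    rw [integral_normalizedField_pow μ hLne hfr (2 * n + 1)]
    refine mul_eq_zero_of_right _ (Finset.sum_eq_zero fun p _ => ?_)
    rw [hodd ⟨n, rfl⟩ p, mul_zero]

/-- **`criticalSmearedMGF_bound_highDim_nonneg` from the two finite-graph random-current facts.**
For `d > 4`, `f ∈ C_c(ℝ^d)` with `f ≥ 0`, there is `C_f > 0` with
`|⟨exp[z T_{f,L} - (z²/2)⟨T_{f,L}²⟩_{β_c}]⟩_{β_c} - 1| ≤ C_f z⁴ / L^{d-4}` for all `L ≥ 1`,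
`z ∈ ℝ` — the display of Duminil-Copin, ICM 2022, §6.4 / Aizenman CDM 2020 (7.9) with (8.5) /
Panis 2023 Thm 5.5, at `β = β_c` for non-negative test functions — GRANTED ONLY the finite-graph
tree diagram bound (`treeDiagramBound`, Aizenman 1982; CDM 2020 Lemma 8.1/(8.2)) and the upper
half of Aizenman's inequality in finite volume (`aizenman_pairingSum_sub_nPoint_le_finite`,
[Aiz82] Prop. 12.1 via the switching lemma). Everything else in the printed proof is a theorem
of the tree: Gaussian domination of the `2n`-point functions
(`aizenman_nPoint_le_pairingSum_finite_holds`), the smearing and the summation over `n`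
(`abs_criticalSmearedMGF_sub_one_le_ratio_of_pairingBounds`, where for `f ≥ 0` the prefactor is
`exp 0 = 1`), the `d > 4` bound on `Σ_L⁻² ∑ |U₄|` (`ursellFourSum_criticalBeta_le_of_treeDiagramBound`:
infrared bound, Messager–Miracle-Solé, Griffiths), the free DLR state at `β_c`
(`exists_freeMeasure_holds`), the vanishing of its odd correlations, `m*(β_c) = 0`
(`spontaneousMagnetization_criticalBeta_eq_zero_holds`, ADS 2015) and the identification of
`⟨·⟩_{β_c}` with that state (`criticalSmearedMGF_eq`). Here `C_f = 24 ‖f‖_∞⁴ C_d r^{4d} + 1` with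
`f` vanishing outside `[-r, r]^d`, `r ≥ 1`.
[cite: DuminilCopinICM2022, §6.4 (display)] [cite: AizenmanCDM2020, §7 eq. (7.9), Lemma 8.1, §8.1 eq. (8.5)] [cite: Panis2023Triviality, Thm. 5.5] [cite: AizenmanDuminilCopinAnnals2021, arXiv:1912.07973 §1.3 and §6.3 (p. 26)] [cite: AizenmanCMP1982] [cite: FrohlichTrivialityNPB1982] -/
@[deprecated "vacuous since 2026-08-15: its hypothesis Literature.Probability.LatticeModels.aizenman_pairingSum_sub_nPoint_le_finite (the S_{2n-4} form quoted by Aizenman-Duminil-Copin 2021 (6.44)) is refuted (not_aizenman_pairingSum_sub_nPoint_le_finite, AizenmanWickBoundLocal.lean) and deprecated in HighDimTrivialityWick.lean; source-form replacement (Aizenman 1982 Prop. 12.1 = aizenman_wickDeviation_le_finite, proved): criticalSmearedMGF_bound_highDim_nonneg_holds (IsingTrivialityFromDimensionFourTwoFacts.lean)" (since := "2026-08-15")]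
theorem criticalSmearedMGF_bound_highDim_nonneg.of_treeDiagramBound (hTB : treeDiagramBound)
    (hupF : aizenman_pairingSum_sub_nPoint_le_finite) :
    criticalSmearedMGF_bound_highDim_nonneg := by
  intro d hd f hf hfs hf0
  have hβ := criticalBeta_nonneg d
  have hm' : spontaneousMagnetization d (criticalBeta d) = 0 :=
    spontaneousMagnetization_criticalBeta_eq_zero_holds (by omega)
  obtain ⟨μ, hμG, hTI, hcorr⟩ := exists_freeMeasure_holds d 0 hβ le_rfl
  haveI : IsProbabilityMeasure μ := hμG.1
  have hμ : ∀ A, spinCorr μ A = plusCorr d (criticalBeta d) 0 A := fun A =>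
    (hcorr A).trans (freeCorr_eq_plusCorr_of_spontaneousMagnetization_eq_zero hβ hm' A)
  have hodd : ∀ {n : ℕ}, Odd n → ∀ x : Fin n → Site d, ∫ σ, ∏ i, spinAt (x i) σ ∂μ = 0 :=
    fun hn x => integral_prod_spinAt_eq_zero_of_freeCorr hβ hcorr hn x
  have hlow : PairingLowerBound μ :=
    pairingLowerBound_of_finite aizenman_nPoint_le_pairingSum_finite_holds hβ hcorr
  have hup : PairingUpperBound μ := pairingUpperBound_of_finite hupF hβ hcorr
  obtain ⟨r, hr1, hfr⟩ := exists_cube_of_hasCompactSupport f hfs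
  have hr0 : 0 ≤ r := zero_le_one.trans hr1
  obtain ⟨C, hC, hS⟩ := ursellFourSum_criticalBeta_le_of_treeDiagramBound (d := d) hTB (by omega)
  have hA0 : 0 ≤ 24 * (⨆ x, |f x|) ^ 4 := mul_nonneg (by norm_num) (pow_nonneg (iSup_abs_nonneg f) 4)
  have hK0 : 0 ≤ 24 * (⨆ x, |f x|) ^ 4 * (C * r ^ (4 * d)) :=
    mul_nonneg hA0 (mul_nonneg hC.le (pow_nonneg hr0 _))
  refine ⟨24 * (⨆ x, |f x|) ^ 4 * (C * r ^ (4 * d)) + 1, by linarith, fun L hL z => ?_⟩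
  have hL1 : (1 : ℝ) ≤ (L : ℝ) := Nat.one_le_cast.mpr hL
  have hLp : 0 < (L : ℝ) ^ (d - 4) := pow_pos (Nat.cast_pos.mpr (by omega)) _
  have habs : (fun x => |f x|) = f := funext fun x => abs_of_nonneg (hf0 x)
  have key := abs_criticalSmearedMGF_sub_one_le_ratio_of_pairingBounds hμG hμ hlow hup hodd hf hfr hL z
  have hW : (∫ σ, normalizedField μ L (fun x => |f x|) σ ^ 2 ∂μ) =
      ∫ σ, normalizedField μ L f σ ^ 2 ∂μ := by rw [habs]
  rw [hW, sub_self, mul_zero, Real.exp_zero, one_mul] at key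
  have hz4 : 0 ≤ z ^ 4 := by positivity
  have hSL := hS μ hTI hcorr (L : ℝ) r hL1 hr1
  calc |criticalSmearedMGF d f L z - 1| ≤ 24 * (⨆ x, |f x|) ^ 4 * ursellFourSum μ L r * z ^ 4 := key
    _ ≤ 24 * (⨆ x, |f x|) ^ 4 * (C * r ^ (4 * d) / (L : ℝ) ^ (d - 4)) * z ^ 4 :=
        mul_le_mul_of_nonneg_right (mul_le_mul_of_nonneg_left hSL hA0) hz4
    _ = 24 * (⨆ x, |f x|) ^ 4 * (C * r ^ (4 * d)) * (z ^ 4 / (L : ℝ) ^ (d - 4)) := by ring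
    _ ≤ (24 * (⨆ x, |f x|) ^ 4 * (C * r ^ (4 * d)) + 1) * (z ^ 4 / (L : ℝ) ^ (d - 4)) :=
        mul_le_mul_of_nonneg_right (by linarith) (div_nonneg hz4 hLp.le)
    _ = (24 * (⨆ x, |f x|) ^ 4 * (C * r ^ (4 * d)) + 1) * z ^ 4 / (L : ℝ) ^ (d - 4) := by
        rw [mul_div_assoc]

/-- **`criticalSmearedMGF_bound_highDim_abs` (general signed `f`, printed `|f|`-prefactor) from
the two finite-graph random-current facts**: for `d > 4` and `f ∈ C_c(ℝ^d)` there is `C_f > 0`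
with `|⟨exp[z T_{f,L} - (z²/2)⟨T_{f,L}²⟩]⟩_{β_c} - 1| ≤ exp((z²/2)(⟨T_{|f|,L}²⟩_{β_c} - ⟨T_{f,L}²⟩_{β_c})) · C_f z⁴ / L^{d-4}`
for all `L ≥ 1`, `z ∈ ℝ` (Aizenman CDM 2020, (7.9)–(7.10) with (8.5); Panis 2023, Thm 5.5),
granted `treeDiagramBound` and `aizenman_pairingSum_sub_nPoint_le_finite` only
(`abs_criticalSmearedMGF_sub_one_le_ratio_of_pairingBounds`, `ursellFourSum_criticalBeta_le_of_treeDiagramBound`,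
`criticalSmearedVariance_eq_integral`). [cite: AizenmanCDM2020, §7 eqs. (7.9)–(7.10) and §8.1 eq. (8.5)] [cite: Panis2023Triviality, Thm. 5.5] -/
@[deprecated "vacuous since 2026-08-15: its hypothesis Literature.Probability.LatticeModels.aizenman_pairingSum_sub_nPoint_le_finite (the S_{2n-4} form quoted by Aizenman-Duminil-Copin 2021 (6.44)) is refuted (not_aizenman_pairingSum_sub_nPoint_le_finite, AizenmanWickBoundLocal.lean) and deprecated in HighDimTrivialityWick.lean; source-form replacement (Aizenman 1982 Prop. 12.1 = aizenman_wickDeviation_le_finite, proved): criticalSmearedMGF_bound_highDim_abs_holds (IsingTrivialityFromDimensionFourTwoFacts.lean)" (since := "2026-08-15")]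
theorem criticalSmearedMGF_bound_highDim_abs.of_treeDiagramBound (hTB : treeDiagramBound)
    (hupF : aizenman_pairingSum_sub_nPoint_le_finite) :
    criticalSmearedMGF_bound_highDim_abs := by
  intro d hd f hf hfs
  have hβ := criticalBeta_nonneg d
  have hm' : spontaneousMagnetization d (criticalBeta d) = 0 :=
    spontaneousMagnetization_criticalBeta_eq_zero_holds (by omega)
  obtain ⟨μ, hμG, hTI, hcorr⟩ := exists_freeMeasure_holds d 0 hβ le_rfl
  haveI : IsProbabilityMeasure μ := hμG.1
  have hμ : ∀ A, spinCorr μ A = plusCorr d (criticalBeta d) 0 A := fun A =>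
    (hcorr A).trans (freeCorr_eq_plusCorr_of_spontaneousMagnetization_eq_zero hβ hm' A)
  have hodd : ∀ {n : ℕ}, Odd n → ∀ x : Fin n → Site d, ∫ σ, ∏ i, spinAt (x i) σ ∂μ = 0 :=
    fun hn x => integral_prod_spinAt_eq_zero_of_freeCorr hβ hcorr hn x
  have hlow : PairingLowerBound μ :=
    pairingLowerBound_of_finite aizenman_nPoint_le_pairingSum_finite_holds hβ hcorr
  have hup : PairingUpperBound μ := pairingUpperBound_of_finite hupF hβ hcorr
  obtain ⟨r, hr1, hfr⟩ := exists_cube_of_hasCompactSupport f hfs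
  have hr0 : 0 ≤ r := zero_le_one.trans hr1
  have hfar : ∀ x, (fun y => |f y|) x ≠ 0 → ∀ i, |x i| ≤ r := fun x hx =>
    hfr x (abs_ne_zero.mp hx)
  obtain ⟨C, hC, hS⟩ := ursellFourSum_criticalBeta_le_of_treeDiagramBound (d := d) hTB (by omega)
  have hA0 : 0 ≤ 24 * (⨆ x, |f x|) ^ 4 := mul_nonneg (by norm_num) (pow_nonneg (iSup_abs_nonneg f) 4)
  have hK0 : 0 ≤ 24 * (⨆ x, |f x|) ^ 4 * (C * r ^ (4 * d)) :=
    mul_nonneg hA0 (mul_nonneg hC.le (pow_nonneg hr0 _))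
  refine ⟨24 * (⨆ x, |f x|) ^ 4 * (C * r ^ (4 * d)) + 1, by linarith, fun L hL z => ?_⟩
  have hL1 : (1 : ℝ) ≤ (L : ℝ) := Nat.one_le_cast.mpr hL
  have hLp : 0 < (L : ℝ) ^ (d - 4) := pow_pos (Nat.cast_pos.mpr (by omega)) _
  have key := abs_criticalSmearedMGF_sub_one_le_ratio_of_pairingBounds hμG hμ hlow hup hodd hf hfr hL z
  rw [criticalSmearedVariance_eq_integral hμ hfar hL, criticalSmearedVariance_eq_integral hμ hfr hL]
  have hz4 : 0 ≤ z ^ 4 := by positivity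
  have hSL := hS μ hTI hcorr (L : ℝ) r hL1 hr1
  refine key.trans (mul_le_mul_of_nonneg_left ?_ (Real.exp_pos _).le)
  calc 24 * (⨆ x, |f x|) ^ 4 * ursellFourSum μ L r * z ^ 4
      ≤ 24 * (⨆ x, |f x|) ^ 4 * (C * r ^ (4 * d) / (L : ℝ) ^ (d - 4)) * z ^ 4 :=
        mul_le_mul_of_nonneg_right (mul_le_mul_of_nonneg_left hSL hA0) hz4
    _ = 24 * (⨆ x, |f x|) ^ 4 * (C * r ^ (4 * d)) * (z ^ 4 / (L : ℝ) ^ (d - 4)) := by ring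
    _ ≤ (24 * (⨆ x, |f x|) ^ 4 * (C * r ^ (4 * d)) + 1) * (z ^ 4 / (L : ℝ) ^ (d - 4)) :=
        mul_le_mul_of_nonneg_right (by linarith) (div_nonneg hz4 hLp.le)
    _ = (24 * (⨆ x, |f x|) ^ 4 * (C * r ^ (4 * d)) + 1) * z ^ 4 / (L : ℝ) ^ (d - 4) := by
        rw [mul_div_assoc]

/-- **The `d > 4` half of the barrier from the two finite-graph facts**: for `d ≥ 5` the critical
nearest-neighbour Ising model on `ℤ^d` has no non-Gaussian smeared scaling limit, granted
`treeDiagramBound` and `aizenman_pairingSum_sub_nPoint_le_finite` (Aizenman 1982, Fröhlich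
1982; Aizenman CDM 2020 Thm 2.2 / Cor. 7.3). Compare `not_hasNonGaussianCriticalSmearing_of_five_le`
of the sibling file, whose second hypothesis is the `d ≥ 5` named fact `panis_ursellFourSum_le`
(an all-`β`, all-DLR-states statement); here that input is replaced by the finite-graph tree
diagram bound, through `ursellFourSum_criticalBeta_le_of_treeDiagramBound`.
[cite: AizenmanCDM2020, Theorem 2.2 and §7 Cor. 7.3] [cite: DuminilCopinICM2022, §6.4] -/
@[deprecated "vacuous since 2026-08-15: its hypothesis Literature.Probability.LatticeModels.aizenman_pairingSum_sub_nPoint_le_finite (the S_{2n-4} form quoted by Aizenman-Duminil-Copin 2021 (6.44)) is refuted (not_aizenman_pairingSum_sub_nPoint_le_finite, AizenmanWickBoundLocal.lean) and deprecated in HighDimTrivialityWick.lean; source-form replacement (Aizenman 1982 Prop. 12.1 = aizenman_wickDeviation_le_finite, proved): criticalSmearedMGF_bound_highDim_abs_holds with IsingTrivialityFromDimensionFour.of_ursellFourSum_le (IsingTrivialityFromDimensionFourTwoFacts.lean)" (since := "2026-08-15")]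
theorem not_hasNonGaussianCriticalSmearing_of_five_le_of_treeDiagramBound
    (hTB : treeDiagramBound) (hupF : aizenman_pairingSum_sub_nPoint_le_finite) {d : ℕ}
    (hd : 5 ≤ d) : ¬ HasNonGaussianCriticalSmearing d :=
  (criticalSmearedMGF_bound_highDim_abs.of_treeDiagramBound hTB hupF).not_hasNonGaussianCriticalSmearing
    (fun {_} => spontaneousMagnetization_criticalBeta_eq_zero_holds) hd

/-- **The barrier from the two finite-graph facts and the `d = 4` bound.**
`IsingTrivialityFromDimensionFour` granted (i) Aizenman's upper inequality in finite volume
(`aizenman_pairingSum_sub_nPoint_le_finite`), (ii) the finite-graph tree diagram bound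
(`treeDiagramBound`) — replacing the `d ≥ 5` DLR-state fact `panis_ursellFourSum_le` of
`IsingTrivialityFromDimensionFour.of_threeFacts` — and (iii) the `d = 4` bound
`aizenmanDuminilCopin_ursellFourSum_le` (Aizenman–Duminil-Copin 2021, Thm 1.3 with §6.3, the
multiscale improvement, which is specific to `d = 4`). [cite: AizenmanDuminilCopinAnnals2021, Thm 1.3, Prop. 1.4 and §6.3 (p. 26)] [cite: AizenmanCDM2020, Lemma 8.1 and §8.1 eq. (8.5)] -/
@[deprecated "vacuous since 2026-08-15: its hypothesis Literature.Probability.LatticeModels.aizenman_pairingSum_sub_nPoint_le_finite (the S_{2n-4} form quoted by Aizenman-Duminil-Copin 2021 (6.44)) is refuted (not_aizenman_pairingSum_sub_nPoint_le_finite, AizenmanWickBoundLocal.lean) and deprecated in HighDimTrivialityWick.lean; source-form replacement (Aizenman 1982 Prop. 12.1 = aizenman_wickDeviation_le_finite, proved): IsingTrivialityFromDimensionFour.of_ursellFourSum_le / .of_adc (IsingTrivialityFromDimensionFourTwoFacts.lean)" (since := "2026-08-15")]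
theorem IsingTrivialityFromDimensionFour.of_treeDiagramBound
    (hupF : aizenman_pairingSum_sub_nPoint_le_finite) (hTB : treeDiagramBound)
    (hS₄ : aizenmanDuminilCopin_ursellFourSum_le) : IsingTrivialityFromDimensionFour := by
  intro d hd
  rcases hd.eq_or_lt with h4 | hlt
  · subst h4
    exact not_hasNonGaussianCriticalSmearing_four hupF hS₄
  · exact not_hasNonGaussianCriticalSmearing_of_five_le_of_treeDiagramBound hTB hupF hlt

end MGF

end Literature.Barriers.CriticalPhenomena

end
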